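import Literature.MathematicalPhysics.QuantumFieldTheory.Balaban1983to89.Node00.N24ItemsStage13AtThm1CCMWOfStepRSepCoPH
import Summits.QuantumFields.YangMills.Theorems.BalabanUVNodesK0ROfStepTokensRCubeB
import Summits.QuantumFields.YangMills.Theorems.BalabanUVNodesN07Thm1Top7FromProp8GuardedB

/-!
# NODE N24 AT THE V16 K0⁷ WITNESS WITH THE K0 SIDE OPENED TO EXACTLY plan g77's V16 STUB BODIES (`N = 2`, `j = 3`): K1⁷'s θ-KEYED CONSEQUENT AND THE REGISTERED RUNG BODIES AT THE
# HISTORY-BLIND DOOR OVER THE CURED RESIDUAL OF THE WINDOWED CUBE WITNESS `θ₁₅ᶜᶜᴹᵂ(3; γ; ε₀, ε₂₉; B₃, B₃', a₀, a₁')`, the door provisos `hP` DISCHARGED BY NAME modulo [15] Prop. 8's top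
# step (stub 1 opened), [6] Prop. 6 at NODE 00's member (stub 2 opened), the window `0 < γ ≤ ½`, the thresholds and stub 3ʷ's WINDOWED β-box on `]0, γ]` of the β of record of
# V15's witness `θ₁₅ᶜᶜᴹ(3; …)` (`0 ≤ b`, `β'·γ² ≤ ¾`; stub 3ʷ's ∃-body opened) and `4 ≤ F.m` ((δ)) — for any gauge constant `B₃' ≥ b9Of F L³ B₁ · B₃` and ceiling `0 < a₁' ≤ min a₁ (a0Of F 2 L³ B₁ c₁ ∕ B₃)`

STAGE-2 SIBLING (dag-n24-c g20; director-ym №365 (2) ∕ №366 R1–R6; S2-campaign row 10 Thm, TIER 2 «post-seam additive»): this module is the ᴮ SIBLING `…N24AtThm1CCMWDoorOfStepTokensB` of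
`Thm/BalabanUVNodesN24AtThm1CCMWDoorOfStepTokens` (same six short declaration names, new namespace ⇒ new FQNs; the old module is NOT touched and is RESIDUE after the Stage-2 seam —
red on its own text, not false).  Every displayed [15] Prop-8 top-step token is now the GUARDED `(bd, Dat)` ᴮ token at the cube floor `floorGuard F ((11·4+3·L)·L)`, print's bond datum
`lamDatum F` ([14] (2.3)) and the (7)-data predicate of record `dataSmall7PTopOf F 2`: `Prop8RegSepTopStepGB F 2 suppDom (floorGuard F ((11·4+3·L)·L)) (lamDatum F) (dataSmall7PTopOf F 2) B₃ a₀ a₁`;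
the suppliers are the ᴮ names — dag-n07 53′ `N07Thm1Top7FromProp8GuardedB.variationalThm1RegSepCoP7MGB_of_prop8TopStepGB_lamDatum` ((8)ᴮ from the guarded top step at print's datum),
S1b `variationalThm1GaugeRegSepCoP7MGB_of_gauge9TopStepGB`, k0-s1-w3's F1B `K0ROfStepTokensRCubeB.gauge9R_cube_of_prop8TopStep_of_prop6Member` (FILE C's cube arithmetic, ᴮ currency) — and
row 10's in-place re-keyed `Node00/N24ItemsStage13AtThm1CCMWOfStepRSepCoPH` door (chain B by node00-def-T).  The prose «(8) ∕ the R gauge sentence ∕ the R (9)-step» below denotes these ᴮ tokens;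
proofs are otherwise verbatim.  Re-keying bookkeeping only — nothing of Bałaban asserted. [14] = [Balaban1984PropagatorsII].

TRACK A (YM-PLAN §2d, node N24 of 28 = binder B2 `hB : B16.EndStatementBPrinted D.C`), seat `pub-ymgap-dag-n24-c` (R134 fan-out seat, strategy s2; gen 7, Part 10).  Key of record: K1⁷
`StabilityBAtRecordR13SepCoPH` = stmt-QuantumFields-20542; this file `--supports` it as a helper (Summits lane: it imports dag-n21-c's FILE C `BalabanUVNodesK0ROfStepTokensRCube` and,
through it, dag-n07-e's bridge `BalabanUVNodesN07Thm1Top7FromProp8`).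
WHY (dag-n21-c g12 LOCATED-WINDOW + INTENT-1…4, INBOX l.22290; plan g77 V16 design l.22324): V16 re-cuts V15's stub 3 to 3ʷ «∀ letters, guards → (8) → R-(9)-step at `(L³, (44+3L)L)` →
∃ γ ε₀ ε₂₉ b β′, 0 < γ ≤ ½ ∧ 0 < ε₀ ∧ 0 < ε₂₉ ∧ 0 ≤ b ∧ β′·γ² ≤ ¾ ∧ the box of `betaOfRecord₁₃ F 2 θ₁₅ᶜᶜᴹ(3; …)` on `]0, γ]`» (the SAME β as 3′, smaller box; on that box it IS the window
edition's β — dag-n21-c A2ʷ `betaOfRecord₁₃_theta13OfThm1CCMW_eq_of_mem`), the K0 witness becoming `θ₁₅ᶜᶜᴹᵂ(3; γ)`; FILE Cʷ's closers stay ABSTRACT (`∃ θ, …`).  The K1⁷ closer working AT that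
witness needs `hP` POINTED (Part 9 `N24ItemsStage13AtThm1CCMWOfStepRSepCoPH` opened it to the two SENTENCES); §0 here opens it further to the STUB BODIES — the V15∕V16 chain kept POINTED:
Prop. 8 ⇒ (8) at the shrunk ceiling by dag-n07-e's `variationalThm1RegSepCoP7MGB_of_prop8TopStepGB_lamDatum` (`Prop8RegSepTopStepGB.of_le`), Prop. 8 ∧ Prop. 6 ⇒ the window-blind R (9)-step at
`(L³, (11·4+3L)·L; B₃, b9Of·B₃, a₀, min a₁ (a0Of∕B₃))` by FILE C's `gauge9R_cube_of_prop8TopStep_of_prop6Member` ⇒ the (9)-line-1 sentence by B′, weakened to `(B₃', a₁')` by `.mono ∕ .of_le`;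
collar by A2ʷ's `collar_le_M₁_theta13OfThm1CCMW`; history clauses by A2ʷ's `_half` lemmas from stub 3ʷ's box on θ₁₅ᶜᶜᴹ(3)'s β; then FILE Bʷ's pointed
`provisos₁₃SepCoP_theta13OfThm1CCMW_of_thm1GaugeR` at `j := 3`, `hjm := hm`, through the two doors.  §2 = Part 8 §2's five door forms at `N := 2`, `j := 3` with `hP := §0`.
TYPING NOTE: the witness letters are ATOMIC (`B₃'`, `a₁'` + the two inequalities): with the compound choices written inside `theta13OfThm1CCMW F 2 3 γ …` the S-bound H-pinned view's
`ops` binder puts a `whnf` over the cliff (2·10⁵ heartbeats) in the three `pinX3HS` statements — the same class as the nested-pin gotcha; atomic letters elaborate in seconds.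
So «WHICH CHILD BLOCKS K1⁷», kernel form (§2 rung-1 hypothesis list): K0 side = V16's three stubs' BODIES + `4 ≤ F.m`; then the world S-bound to the H-pinned (or X-rebound)
four-pin view (letters free; `w.γ ≤ γ`); N05 ∕ N06 ∕ N07 ∕ N08 ∕ N09 (+ `h09T`) ∕ N10 ∕ N11 (S1ᵀ) ∕ N12 leaves; N13's (UV₁₃); and (consequent ∕ rung 2) the WORLD's β-box letters `hlo ∕ hhi` on
the window edition's β (at `w.γ = γ`, `w.b = b`, `w.βup = β'` they ARE stub 3ʷ's `hbox ∕ hbox'` through dag-n21-c `betaLowerH∕betaUpperH_theta13OfThm1CCMW_of_half`).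
A NEW importing module (imports Part 9 + FILE C).  THEOREMS ONLY, def-free, sorry-free, standard axioms; every §2 proof is ONE application of the Part 8 door theorem at `N := 2`.

WHAT THIS FILE PROVES (6 theorems).  §0 `N24_provisos₁₃SepCoPH_door_theta13OfThm1CCMW_cube_of_prop8TopStep_of_prop6Member_of_betaBoxW`.  §2 `N24_stabilityBR13SepCoPH_thetaShape20_rebindX_fourPin_pointed_theta13OfThm1CCMW_cube_of_prop8TopStep_of_prop6Member_of_betaBoxW_door`,
`N24_betaWindowAtSomeRecord₁₃SepCoPH_of_rebindX_fourPin_pointed_of_boxH_theta13OfThm1CCMW_cube_of_prop8TopStep_of_prop6Member_of_betaBoxW_door`, `N24_stabilityBR13SepCoPH_thetaShape20_pinX3HS_fourPin_pointed_theta13OfThm1CCMW_cube_of_prop8TopStep_of_prop6Member_of_betaBoxW_door`,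
`N24_nodesAtSomeRecordS₁₃SepCoPH_of_pinX3HS_fourPin_pointed_theta13OfThm1CCMW_cube_of_prop8TopStep_of_prop6Member_of_betaBoxW_door` (rung 1; at `N = 2` its conclusion is the registered v5 text `NodesAtSomeRecord13PWS F`'s body),
`N24_betaWindowAtSomeRecordS₁₃SepCoPH_of_pinX3HS_fourPin_pointed_of_boxH_theta13OfThm1CCMW_cube_of_prop8TopStep_of_prop6Member_of_betaBoxW_door` (rung 2; `BetaWindowAtSomeRecord13S F`'s body).

HONEST FRAMING: composition BY NAME; nothing of Bałaban's asserted — [15] Prop. 8's top step, [6] Prop. 6 at the member, the window, the windowed β-box, every child leaf and `4 ≤ F.m` are DISPLAYED hypotheses;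
K0⁷ ∕ K1⁷ NOT closed; N24 COMPOSITE — no discharge, no count moved (5∕27), no stub closed; one finite T⁴ programme at fixed ε; NOT continuum ∕ ℝ⁴ ∕ OS ∕ mass gap ∕ Clay.
-/

noncomputable section

open scoped Matrix.Norms.L2Operator

namespace Summit.QuantumFields.YangMills.BalabanUVNodes.N24AtThm1CCMWDoorOfStepTokensB

open Literature.MathematicalPhysics.QuantumFieldTheory.Balaban1983to89
open Literature.MathematicalPhysics.QuantumFieldTheory.Balaban1983to89.Node00
open DagBinding T4Continuum T4DatumAssembly FlowStepRuns AveragingRT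
open FlowStep (BetaLowerH BetaUpperH)
open Summit.QuantumFields.YangMills.BalabanUVNodes.N07Thm1Top7FromProp8GuardedB (variationalThm1RegSepCoP7MGB_of_prop8TopStepGB_lamDatum)
open Summit.QuantumFields.YangMills.Theorems.K0ROfStepTokensRCubeB (gauge9R_cube_of_prop8TopStep_of_prop6Member)

variable {F : T4Family}

/-! ## §0. The door provisos at the windowed cube witness POINTED, from V16's stub bodies (FILE C's window-blind (9)-step + dag-n07-e's bridge + FILE Bʷ) -/

/-- **★★ THE v1.7 DOOR PROVISOS AT THE WINDOWED CUBE WITNESS `θ₁₅ᶜᶜᴹᵂ(3; γ; ε₀, ε₂₉; B₃, B₃', a₀, a₁')`, `N = 2`, ON PRINT's RANGE `4 ≤ F.m`, POINTED, FROM EXACTLY V16's STUB BODIES**: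
[15] Prop. 8's top step at `(B₃, a₀, a₁)` with the floor `2L² ≤ B₃` and `0 < a₀` (stub 1; its `0 < a₁` is not needed once the ceiling is shrunk to `a₁' ≤ a₁`), [6] Prop. 6 at NODE 00's
member `(B₁, c₁)` (stub 2), the window `0 < γ ≤ ½`, thresholds `0 < ε₀`, `0 < ε₂₉` and the windowed β-box `(b, β')` on `]0, γ]` of the β of record of V15's witness
`betaOfRecord₁₃ F 2 (theta13OfThm1CCM F 2 3 ε₀ ε₂₉ B₃ B₃' a₀ a₁')` with `0 ≤ b`, `β'·γ² ≤ ¾` (stub 3ʷ's ∃-body), `4 ≤ F.m` ((δ)) — for ANY gauge constant `B₃' ≥ b9Of F L³ B₁ · B₃` and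
ANY ceiling `0 < a₁' ≤ min a₁ (a0Of F 2 L³ B₁ c₁ ∕ B₃)` (V16's exact letters with `le_rfl`; letters ATOMIC in the statement).  The chain kept POINTED: Prop. 8 ⇒ (8) at `a₁'` by
dag-n07-e's bridge (`Prop8RegSepTopStepGB.of_le`), Prop. 8 ∧ Prop. 6 ⇒ the window-blind R (9)-step at the cube letters by FILE C's `gauge9R_cube_of_prop8TopStep_of_prop6Member` ⇒ the
(9)-line-1 sentence by B′ `variationalThm1GaugeRegSepCoP7MGB_of_gauge9TopStepGB`, weakened to `(B₃', a₁')` by B′'s `.mono ∕ .of_le`; collar `(11·4+3L)·L ≤ L³ = ν.M₁` by A2ʷ's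
`collar_le_M₁_theta13OfThm1CCMW`; history clauses at `θ₁₅ᶜᶜᴹᵂ` from the box on `θ₁₅ᶜᶜᴹ`'s β by A2ʷ's `hmono_theta13OfThm1CCMW_of_betaLowerH_half` ∕ `hcompRev_theta13OfThm1CCMW_of_betaBox_half`;
then FILE Bʷ's pointed `provisos₁₃SepCoP_theta13OfThm1CCMW_of_thm1GaugeR` at `j := 3`, `hjm := hm`, through the two doors.  CONDITIONAL on every displayed hypothesis; nothing of Bałaban
asserted; K0⁷ NOT closed here.
[cite: Balaban1985Variational, Thm 1 (8)–(9) p.279, (144)–(152) pp.300–301, Prop. 8 p.304; Balaban1985RegularSpaces, (1.3)–(1.9) p.77, Prop. 6 p.99; Balaban1988Convergent, Thm 1 p.262, (2.4)–(2.8) pp.255–256, (2.12)–(2.13) p.256, (2.21) p.258, (3.16)–(3.23) pp.268–270; Balaban1987RG1, (0.1) p.251, Thm 1 p.255, (1.11)–(1.12) p.262, (1.20)–(1.22) p.264, §1 p.264; Balaban1989LargeFieldI, (0.2)–(0.4) p.176; Balaban1989LargeFieldII, (1.4) p.357] -/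
theorem N24_provisos₁₃SepCoPH_door_theta13OfThm1CCMW_cube_of_prop8TopStep_of_prop6Member_of_betaBoxW (F : T4Family) (hm : 4 ≤ F.m) {B₃ a₀ a₁ B₁ c₁ B₃' a₁' : ℝ}
    (hB₃ : 2 * (F.L : ℝ) ^ 2 ≤ B₃) (ha₀ : 0 < a₀)
    (h8 : Prop8RegSepTopStepGB F 2 (fun ν K Ω => suppDomOfRecord F ν K Ω) (floorGuard F ((11 * 4 + 3 * F.L) * F.L)) (lamDatum F) (dataSmall7PTopOf F 2) B₃ a₀ a₁) (hB₁ : 0 ≤ B₁) (hc₁ : 0 < c₁)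
    (hP6 : letI : CStarAlgebra (MatA 2) := {}; B8.Prop6Printed 4 (F.L : ℝ) B₁ c₁ (fun i : B8LeafModelZd.ZdIdx 4 F.L => zdCub (MatA 2) F.L i))
    (hB₉ : b9Of F (F.L ^ 3) B₁ * B₃ ≤ B₃') (ha₁' : 0 < a₁') (ha₁'le : a₁' ≤ min a₁ (a0Of F 2 (F.L ^ 3) B₁ c₁ / B₃))
    {γ ε₀ ε₂₉ b β' : ℝ} (hγ₀ : 0 < γ) (hγh : γ ≤ 1 / 2) (hε : 0 < ε₀) (hε' : 0 < ε₂₉) (hb : 0 ≤ b)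
    (hbox : BetaLowerH b γ (betaOfRecord₁₃ F 2 (theta13OfThm1CCM F 2 3 ε₀ ε₂₉ B₃ B₃' a₀ a₁')))
    (hbox' : BetaUpperH β' γ (betaOfRecord₁₃ F 2 (theta13OfThm1CCM F 2 3 ε₀ ε₂₉ B₃ B₃' a₀ a₁'))) (hβ' : β' * γ ^ 2 ≤ 3 / 4) :
    (Stage13HParams.ofHistoryBlind F 2 ⟨theta13OfThm1CCMW F 2 3 γ ε₀ ε₂₉ B₃ B₃' a₀ a₁', ZrOfRecord₁₃ F 2 (theta13OfThm1CCMW F 2 3 γ ε₀ ε₂₉ B₃ B₃' a₀ a₁')⟩).Provisos₁₃SepCoPH F 2 := by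
  have hL0 : (0 : ℝ) < (F.L : ℝ) := by exact_mod_cast lt_trans Nat.zero_lt_one F.hL.2
  have hBpos : (0 : ℝ) < B₃ := lt_of_lt_of_le (mul_pos two_pos (pow_pos hL0 2)) hB₃
  have hB9 : (0 : ℝ) ≤ B₃' := (mul_nonneg (b9Of_pos (F := F) (F.L ^ 3) hB₁).le hBpos.le).trans hB₉
  exact (provisos₁₃SepCoP_theta13OfThm1CCMW_of_thm1GaugeR (N := 2) (j := 3) hγ₀ hγh hm hε hε' hBpos.le hB9 ha₀ ha₁'
    (variationalThm1RegSepCoP7MGB_of_prop8TopStepGB_lamDatum hBpos (h8.of_le le_rfl (ha₁'le.trans (min_le_left _ _))))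
    ((theta13OfThm1CCMW_M₁ F 2 3 γ ε₀ ε₂₉ B₃ B₃' a₀ a₁') ▸ collar_le_M₁_theta13OfThm1CCMW F 2 γ ε₀ ε₂₉ B₃ B₃' a₀ a₁' (le_refl 3))
    (((variationalThm1GaugeRegSepCoP7MGB_of_gauge9TopStepGB (gauge9R_cube_of_prop8TopStep_of_prop6Member F hBpos h8 hB₁ hc₁ hP6)).mono hB₉).of_le le_rfl ha₁'le)
    (hmono_theta13OfThm1CCMW_of_betaLowerH_half hγh hb hbox) (hcompRev_theta13OfThm1CCMW_of_betaBox_half hγh hBpos.le hB9 ha₀.le ha₁'.le hb hbox hbox' hβ')).ofCured.ofHistoryBlind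


/-! ## §2. `N = 2`, `j = 3`, the cube letters kept atomic: `hP` ⟸ EXACTLY V16's stub bodies (Prop. 8 top step, Prop. 6 at the member, window + thresholds + windowed β-box) + `4 ≤ F.m` -/

/-- **AT THE V16 WITNESS ON PRINT's RANGE `4 ≤ F.m`, `N = 2`, `j = 3`, WITH `hP` DISCHARGED MODULO EXACTLY plan g77's V16 STUB BODIES** — [15] Prop. 8's top step `Prop8RegSepTopStepGB F 2 suppDom (floorGuard F ((11·4+3·L)·L)) (lamDatum F) (dataSmall7PTopOf F 2) B₃ a₀ a₁` with `2L² ≤ B₃`, `0 < a₀`, `0 < a₁` (stub 1 `Prop8StepCoPAt F` opened), [6] Prop. 6 at NODE 00's member `B8.Prop6Printed 4 L B₁ c₁ (zdCub (MatA 2) L ·)` with `0 ≤ B₁`, `0 < c₁` (stub 2 `Prop6MemberB8At F` opened), the window `0 < γ ≤ ½`, the thresholds `0 < ε₀`, `0 < ε₂₉` and stub 3ʷ's WINDOWED β-box `BetaLowerH b γ ∕ BetaUpperH β' γ` (`0 ≤ b`, `β'·γ² ≤ ¾`) of the β OF RECORD OF V15's WITNESS `betaOfRecord₁₃ F 2 θ₁₅ᶜᶜᴹ(3;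 ε₀, ε₂₉; B₃, B₃', a₀, a₁')` (= the window edition's on the box, dag-n21-c `betaLowerH∕betaUpperH_theta13OfThm1CCMW_of_half`) for ANY gauge constant `B₃' ≥ b9Of·B₃` and ceiling `0 < a₁' ≤ min a₁ (a0Of∕B₃)` (V16's exact letters with `le_rfl`) and `hm : 4 ≤ F.m` ((δ)); door provisos BY NAME (§0) through dag-n07-e's bridge, FILE C's window-blind `gauge9R_cube_of_prop8TopStep_of_prop6Member`, B′'s `.mono ∕ .of_le`, A2ʷ's `_half` history lemmas and FILE Bʷ's pointed provisos — AT THE V16 WITNESS SHAPE `Stage13HParams.ofHistoryBlind ⟨θ₁₅ᶜᶜᴹᵂ, ZrOfRecord₁₃ θ₁₅ᶜᶜᴹᵂ⟩` (the history-blind door over the cured residual of the windowed collared `θ₁₅ᶜᶜᴹᵂ(j; γ) = theta13OfThm1CCMW F N j γ ε₀ ε₂₉ B₃ B₃' a₀ a₁`, `0 < γ ≤ ½`; `= ofHistoryBlind (Stage13RParams.ofCured θ₁₅ᶜᶜᴹᵂ)`, `rfl`) — ITEM K1⁷'s θ-KEYED CONSEQUENT WITNESSED BY `(θ, hP)` FROM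 THE POINTED CHILDREN OVER THE X-REBOUND FOUR-PIN VIEW** (§1 into def-T's
`endStatementBPrinted_of_isRecordOfRecord₁₃CCoPH_of_nodes` + module 38's interval β-binder + module 26's window).  COMPOSITE.
[cite: Balaban1989LargeFieldII, Thm 1 p.355, (0.1) pp.355–356, p.391; Balaban1988Convergent, (3.16)–(3.22) pp.268–269; Balaban1987RG1, Thm 3 p.264, (0.17)–(0.20) pp.255–256 and (1.22) p.264, (2.9) p.266; Balaban1985UV3, Thm 1 p.257 (bookkeeping + elementary window)] (= `N24_stabilityBR13SepCoPH_thetaShape20_rebindX_fourPin_pointed` at `θ := the door`; `Admissible` ← dag-n21-c `admissible_theta13OfThm1CCMW_of_le_half` (window + six signs), `SlotsNondegenerate₁₃` ← dag-n21-c `slotsNondegenerate₁₃_theta13OfThm1CCMW` (hypothesis-free), N13's (R₁₃) ← §0 `N24_laws₁₃CoPH_theta13OfThm1CCMW` (= dag-n11-e's generic `rOpLeaf_VOfRecord₁₃CoPH_theta13LiveOfNumerics` at the member) — ALL BY NAME; the β-box pair `hlo ∕ hhi` read at the witness's β of record `betaOfRecord₁₃ F N θ₁₅ᶜᶜᴹᵂ`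 (def-T `βfun_datumOfRecord₁₃SepCoPH`, `rfl`) = the currency of V16's stub 3ʷ (there at `j = 3` on the window `γ = θ₁₅ᶜᶜᴹᵂ.γ`, so the world takes `w.γ ≤ γ`); the unity guard DISCHARGED by `Stage13RParams.ZrUnity.ofHistoryBlind` over K0a FILE 17 `finsum_ζ0_ZrOfRecord₁₃`; `hP : (…).Provisos₁₃SepCoPH F N` at the door — the K0⁷ skeleton's own product — is the ONLY K0-side hypothesis left.) (= `N24_stabilityBR13SepCoPH_thetaShape20_rebindX_fourPin_pointed_theta13OfThm1CCMW_door` with `hP := §0`; signs `0 ≤ B₃` from the floor, `0 ≤ B₃'` from `0 ≤ b9Of·B₃ ≤ B₃'` (`b9Of_pos`); the WORLD's β-box letters `hlo ∕ hhi` (at `w.b`, `w.βup`, `w.γ ≤ ½`; present in the consequent ∕ rung-2 forms only) stay the closer's — at `w.γ = γ`, `w.b = b`, `w.βup = β'` they ARE the K0 box `hbox ∕ hbox'` transferred to the window edition's β by dag-n21-c `betaLowerH∕betaUpperH_theta13OfThm1CCMW_of_half hγh`.) -/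
theorem N24_stabilityBR13SepCoPH_thetaShape20_rebindX_fourPin_pointed_theta13OfThm1CCMW_cube_of_prop8TopStep_of_prop6Member_of_betaBox_door (hm : 4 ≤ F.m) {B₃ a₀ a₁ B₁ c₁ B₃' a₁' : ℝ} (hB₃ : 2 * (F.L : ℝ) ^ 2 ≤ B₃) (ha₀ : 0 < a₀)
    (h8 : Prop8RegSepTopStepGB F 2 (fun ν K Ω => suppDomOfRecord F ν K Ω) (floorGuard F ((11 * 4 + 3 * F.L) * F.L)) (lamDatum F) (dataSmall7PTopOf F 2) B₃ a₀ a₁) (hB₁ : 0 ≤ B₁) (hc₁ : 0 < c₁)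
    (hP6 : letI : CStarAlgebra (MatA 2) := {}; B8.Prop6Printed 4 (F.L : ℝ) B₁ c₁ (fun i : B8LeafModelZd.ZdIdx 4 F.L => zdCub (MatA 2) F.L i))
    (hB₉ : b9Of F (F.L ^ 3) B₁ * B₃ ≤ B₃') (ha₁' : 0 < a₁') (ha₁'le : a₁' ≤ min a₁ (a0Of F 2 (F.L ^ 3) B₁ c₁ / B₃))
    {γ ε₀ ε₂₉ : ℝ} (hγ₀ : 0 < γ) (hγh : γ ≤ 1 / 2) (hε : 0 < ε₀) (hε' : 0 < ε₂₉) {b β' : ℝ} (hb : 0 ≤ b) (hbox : BetaLowerH b γ (betaOfRecord₁₃ F 2 (theta13OfThm1CCM F 2 3 ε₀ ε₂₉ B₃ B₃' a₀ a₁')))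
    (hbox' : BetaUpperH β' γ (betaOfRecord₁₃ F 2 (theta13OfThm1CCM F 2 3 ε₀ ε₂₉ B₃ B₃' a₀ a₁'))) (hβ' : β' * γ ^ 2 ≤ 3 / 4)
    (X' : B12.RunParams → PrintedCarriersR)
    (Mstar : ℕ)
    (ops : OpsY 2 (theta13OfThm1CCMW F 2 3 γ ε₀ ε₂₉ B₃ B₃' a₀ a₁').toStage3Params Mstar)
    (ζ : ResidZ F 2)
    (lamW : ResidW F 2)
    (w : WorldP)
    (hC : w.C = (datumOfRecord₁₃SepCoPH F 2 (Stage13HParams.ofHistoryBlind F 2 ⟨theta13OfThm1CCMW F 2 3 γ ε₀ ε₂₉ B₃ B₃' a₀ a₁', ZrOfRecord₁₃ F 2 (theta13OfThm1CCMW F 2 3 γ ε₀ ε₂₉ B₃ B₃' a₀ a₁')⟩) (N24_provisos₁₃SepCoPH_door_theta13OfThm1CCMW_cube_of_prop8TopStep_of_prop6Member_of_betaBoxW F hm hB₃ ha₀ h8 hB₁ hc₁ hP6 hB₉ ha₁' ha₁'le hγ₀ hγh hε hε' hb hbox hbox' hβ')).C)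
    (hγ : 0 < w.γ ∧ w.γ ≤ (theta13OfThm1CCMW F 2 3 γ ε₀ ε₂₉ B₃ B₃' a₀ a₁').γ)
    (hL : w.L = ((theta13OfThm1CCMW F 2 3 γ ε₀ ε₂₉ B₃ B₃' a₀ a₁').L : ℝ))
    (hup : ∀ P, w.up P = upOfRecord₅C F 2 (((Stage13HParams.ofHistoryBlind F 2 ⟨theta13OfThm1CCMW F 2 3 γ ε₀ ε₂₉ B₃ B₃' a₀ a₁', ZrOfRecord₁₃ F 2 (theta13OfThm1CCMW F 2 3 γ ε₀ ε₂₉ B₃ B₃' a₀ a₁')⟩).rebindX F 2 X').view₁₃CoPHB10YZW F 2 Mstar ops ζ lamW) P)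
    (h05 : ∀ P : B12.RunParams,
      B8LeafR (X' P).d8 (X' P).L8 (X' P).C₂ (X' P).B₁' (X' P).B₀' (X' P).B₁ (X' P).B₂ (X' P).c₁
        (X' P).inp8 (X' P).B₀β (X' P).loc8 (X' P).fam8R (X' P).lan8 (X' P).cub8 (X' P).toAxial8)
    (h06 : B9LeafX (Y9OfRecord 2 (theta13OfThm1CCMW F 2 3 γ ε₀ ε₂₉ B₃ B₃' a₀ a₁').toStage3Params Mstar ops))
    (h07 : B11Leaf (Z11OfRecord F 2 ζ))
    (h08 : PrintedUV3V 2 (theta13OfThm1CCMW F 2 3 γ ε₀ ε₂₉ B₃ B₃' a₀ a₁').L)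
    (h09 : ∀ P : B12.RunParams, B12Sec2to5.Lemma4Printed (X' P).F12 (X' P).c12)
    (h09T : ∀ P : B12.RunParams, (leavesP w P).smallCouplings → (leavesP w P).smallFieldInductive)
    (h10 : ∀ P : B12.RunParams, B9LeafX (Y9OfRecord 2 (theta13OfThm1CCMW F 2 3 γ ε₀ ε₂₉ B₃ B₃' a₀ a₁').toStage3Params Mstar ops) →
      (B10.Thm1PrintedCompact ((((Stage13HParams.ofHistoryBlind F 2 ⟨theta13OfThm1CCMW F 2 3 γ ε₀ ε₂₉ B₃ B₃' a₀ a₁', ZrOfRecord₁₃ F 2 (theta13OfThm1CCMW F 2 3 γ ε₀ ε₂₉ B₃ B₃' a₀ a₁')⟩).rebindX F 2 X').view₁₃CoPHB10YZW F 2 Mstar ops ζ lamW).res.X P).runs10 ∧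
          B10.Thm2Printed ((((Stage13HParams.ofHistoryBlind F 2 ⟨theta13OfThm1CCMW F 2 3 γ ε₀ ε₂₉ B₃ B₃' a₀ a₁', ZrOfRecord₁₃ F 2 (theta13OfThm1CCMW F 2 3 γ ε₀ ε₂₉ B₃ B₃' a₀ a₁')⟩).rebindX F 2 X').view₁₃CoPHB10YZW F 2 Mstar ops ζ lamW).res.X P).runs10) →
        B11Leaf (Z11OfRecord F 2 ζ) → B12Sec2to5.Lemma4Printed (X' P).F12 (X' P).c12 →
          B13.Lemma1Printed (X' P).S13 (X' P).c13 ∧ B13.Lemma2Printed (X' P).S13 (X' P).c13 ∧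
            B13.Lemma3Printed (X' P).S13 (X' P).c13)
    (h11 : ∀ P : B12.RunParams, (leavesP w P).b7 → (leavesP w P).b8 → (leavesP w P).b9 → (leavesP w P).b10 → (leavesP w P).b11 →
      (leavesP w P).smallCouplings → (leavesP w P).smallFieldInductive → (leavesP w P).flowControl →
        ∀ k, k < P.K → SLaw₁₃CoPH F 2 (Stage13HParams.ofHistoryBlind F 2 ⟨theta13OfThm1CCMW F 2 3 γ ε₀ ε₂₉ B₃ B₃' a₀ a₁', ZrOfRecord₁₃ F 2 (theta13OfThm1CCMW F 2 3 γ ε₀ ε₂₉ B₃ B₃' a₀ a₁')⟩) P k → TLaw₁₃CoPH F 2 (Stage13HParams.ofHistoryBlind F 2 ⟨theta13OfThm1CCMW F 2 3 γ ε₀ ε₂₉ B₃ B₃' a₀ a₁', ZrOfRecord₁₃ F 2 (theta13OfThm1CCMW F 2 3 γ ε₀ ε₂₉ B₃ B₃' a₀ a₁')⟩) P k)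
    (h12 : ∀ P : B12.RunParams, B15Leaf (WOfRecord₁₃ F 2 (theta13OfThm1CCMW F 2 3 γ ε₀ ε₂₉ B₃ B₃' a₀ a₁') lamW P))
    (hUV : ∀ P : B12.RunParams, (genFlow (betaOfRecord₁₃ F 2 (theta13OfThm1CCMW F 2 3 γ ε₀ ε₂₉ B₃ B₃' a₀ a₁')) P.g0).InInterval w.γ P.K → ∀ k, k ≤ P.K → SLaw₁₃CoPH F 2 (Stage13HParams.ofHistoryBlind F 2 ⟨theta13OfThm1CCMW F 2 3 γ ε₀ ε₂₉ B₃ B₃' a₀ a₁', ZrOfRecord₁₃ F 2 (theta13OfThm1CCMW F 2 3 γ ε₀ ε₂₉ B₃ B₃' a₀ a₁')⟩) P k →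
      ∀ U : GaugeField (F.P P.K) k (SU 2),
        chiβOfRecord₁₃ F 2 (theta13OfThm1CCMW F 2 3 γ ε₀ ε₂₉ B₃ B₃' a₀ a₁') P.K (gOfRecord₁₃ F 2 (theta13OfThm1CCMW F 2 3 γ ε₀ ε₂₉ B₃ B₃' a₀ a₁') P) k U *
              Real.exp (-(1 / (gOfRecord₁₃ F 2 (theta13OfThm1CCMW F 2 3 γ ε₀ ε₂₉ B₃ B₃' a₀ a₁') P k) ^ 2 * wilsonBGOfRecord F 2 (theta13OfThm1CCMW F 2 3 γ ε₀ ε₂₉ B₃ B₃' a₀ a₁').εbg P k U)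
                - w.em (gOfRecord₁₃ F 2 (theta13OfThm1CCMW F 2 3 γ ε₀ ε₂₉ B₃ B₃' a₀ a₁') P k) * (Fintype.card (Site (F.P P.K) k) : ℝ)) ≤ densOfRecord₁₃ F 2 (theta13OfThm1CCMW F 2 3 γ ε₀ ε₂₉ B₃ B₃' a₀ a₁') P k U ∧
        densOfRecord₁₃ F 2 (theta13OfThm1CCMW F 2 3 γ ε₀ ε₂₉ B₃ B₃' a₀ a₁') P k U ≤ Real.exp (w.ep (gOfRecord₁₃ F 2 (theta13OfThm1CCMW F 2 3 γ ε₀ ε₂₉ B₃ B₃' a₀ a₁') P k) * (Fintype.card (Site (F.P P.K) k) : ℝ)))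
    (hlo : BetaLowerH w.b w.γ (betaOfRecord₁₃ F 2 (theta13OfThm1CCMW F 2 3 γ ε₀ ε₂₉ B₃ B₃' a₀ a₁')))
    (hhi : BetaUpperH w.βup w.γ (betaOfRecord₁₃ F 2 (theta13OfThm1CCMW F 2 3 γ ε₀ ε₂₉ B₃ B₃' a₀ a₁'))) :
    ∃ (θ' : Stage13HParams F 2) (h' : θ'.Provisos₁₃SepCoPH F 2), (θ'.ZhUnity F 2 ∧ θ'.SlotsNondegenerate₁₃ F 2) ∧ θ'.Admissible F 2 ∧
      B16.EndStatementBPrinted (datumOfRecord₁₃SepCoPH F 2 θ' h').C ∧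
      ∃ γ₁ : ℝ, 0 < γ₁ ∧ ∀ γ : ℝ, 0 < γ → γ ≤ γ₁ → ∃ P : B12.RunParams, 1 ≤ P.K ∧ ((datumOfRecord₁₃SepCoPH F 2 θ' h').C P).flow.InInterval γ P.K := by
  have hL0 : (0 : ℝ) < (F.L : ℝ) := by exact_mod_cast lt_trans Nat.zero_lt_one F.hL.2
  have hBpos : (0 : ℝ) < B₃ := lt_of_lt_of_le (mul_pos two_pos (pow_pos hL0 2)) hB₃
  have hB9 : (0 : ℝ) ≤ B₃' := (mul_nonneg (b9Of_pos (F := F) (F.L ^ 3) hB₁).le hBpos.le).trans hB₉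
  exact N24_stabilityBR13SepCoPH_thetaShape20_rebindX_fourPin_pointed_theta13OfThm1CCMW_door (F := F) (N := 2) hγ₀ hγh hε hε' hBpos.le hB9 ha₀ ha₁' (N24_provisos₁₃SepCoPH_door_theta13OfThm1CCMW_cube_of_prop8TopStep_of_prop6Member_of_betaBoxW F hm hB₃ ha₀ h8 hB₁ hc₁ hP6 hB₉ ha₁' ha₁'le hγ₀ hγh hε hε' hb hbox hbox' hβ') X' Mstar ops ζ lamW w hC hγ hL hup h05 h06 h07 h08 h09 h09T h10 h11 h12 hUV hlo hhi

/-- **AT THE V16 WITNESS ON PRINT's RANGE `4 ≤ F.m`, `N = 2`, `j = 3`, WITH `hP` DISCHARGED MODULO EXACTLY plan g77's V16 STUB BODIES** — [15] Prop. 8's top step `Prop8RegSepTopStepGB F 2 suppDom (floorGuard F ((11·4+3·L)·L)) (lamDatum F) (dataSmall7PTopOf F 2) B₃ a₀ a₁` with `2L² ≤ B₃`, `0 < a₀`, `0 < a₁` (stub 1 `Prop8StepCoPAt F` opened), [6] Prop. 6 at NODE 00's member `B8.Prop6Printed 4 L B₁ c₁ (zdCub (MatA 2) L ·)` with `0 ≤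 B₁`, `0 < c₁` (stub 2 `Prop6MemberB8At F` opened), the window `0 < γ ≤ ½`, the thresholds `0 < ε₀`, `0 < ε₂₉` and stub 3ʷ's WINDOWED β-box `BetaLowerH b γ ∕ BetaUpperH β' γ` (`0 ≤ b`, `β'·γ² ≤ ¾`) of the β OF RECORD OF V15's WITNESS `betaOfRecord₁₃ F 2 θ₁₅ᶜᶜᴹ(3; ε₀, ε₂₉; B₃, B₃', a₀, a₁')` (= the window edition's on the box, dag-n21-c `betaLowerH∕betaUpperH_theta13OfThm1CCMW_of_half`) for ANY gauge constant `B₃' ≥ b9Of·B₃` and ceiling `0 < a₁' ≤ min a₁ (a0Of∕B₃)` (V16's exact letters with `le_rfl`) and `hm : 4 ≤ F.m` ((δ)); door provisos BY NAME (§0) through dag-n07-e's bridge, FILE C's window-blind `gauge9R_cube_of_prop8TopStep_of_prop6Member`, B′'s `.mono ∕ .of_le`, A2ʷ's `_half` history lemmas and FILE Bʷ's pointed provisos — AT THE V16 WITNESS SHAPE `Stage13HParams.ofHistoryBlind ⟨θ₁₅ᶜᶜᴹᵂ, ZrOfRecord₁₃ θ₁₅ᶜᶜᴹᵂ⟩`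 (the history-blind door over the cured residual of the windowed collared `θ₁₅ᶜᶜᴹᵂ(j; γ) = theta13OfThm1CCMW F N j γ ε₀ ε₂₉ B₃ B₃' a₀ a₁`, `0 < γ ≤ ½`; `= ofHistoryBlind (Stage13RParams.ofCured θ₁₅ᶜᶜᴹᵂ)`, `rfl`) — THE ∃-BODY OF `BetaWindowAtSomeRecord13` OVER THE X-REBOUND FOUR-PIN VIEW**, witnesses `(θ, hP, w)` (guard `hU` displayed).
[cite: Balaban1989LargeFieldII, Thm 1 p.355, (0.1) pp.355–356, p.391; Balaban1987RG1, Thm 3 p.264, (0.17)–(0.20) pp.255–256 and (1.22) p.264, (2.9) p.266; Balaban1985UV3, Thm 1 p.257 (bookkeeping + elementary window)] (= `N24_betaWindowAtSomeRecord₁₃SepCoPH_of_rebindX_fourPin_pointed_of_boxH` at `θ := the door`; `Admissible` ← dag-n21-c `admissible_theta13OfThm1CCMW_of_le_half` (window + six signs), `SlotsNondegenerate₁₃` ← dag-n21-c `slotsNondegenerate₁₃_theta13OfThm1CCMW` (hypothesis-free), N13's (R₁₃) ← §0 `N24_laws₁₃CoPH_theta13OfThm1CCMW` (= dag-n11-e's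 generic `rOpLeaf_VOfRecord₁₃CoPH_theta13LiveOfNumerics` at the member) — ALL BY NAME; the β-box pair `hlo ∕ hhi` read at the witness's β of record `betaOfRecord₁₃ F N θ₁₅ᶜᶜᴹᵂ` (def-T `βfun_datumOfRecord₁₃SepCoPH`, `rfl`) = the currency of V16's stub 3ʷ (there at `j = 3` on the window `γ = θ₁₅ᶜᶜᴹᵂ.γ`, so the world takes `w.γ ≤ γ`); the unity guard DISCHARGED by `Stage13RParams.ZrUnity.ofHistoryBlind` over K0a FILE 17 `finsum_ζ0_ZrOfRecord₁₃`; `hP : (…).Provisos₁₃SepCoPH F N` at the door — the K0⁷ skeleton's own product — is the ONLY K0-side hypothesis left.) (= `N24_betaWindowAtSomeRecord₁₃SepCoPH_of_rebindX_fourPin_pointed_of_boxH_theta13OfThm1CCMW_door` with `hP := §0`; signs `0 ≤ B₃` from the floor, `0 ≤ B₃'` from `0 ≤ b9Of·B₃ ≤ B₃'` (`b9Of_pos`); the WORLD's β-box letters `hlo ∕ hhi` (at `w.b`, `w.βup`, `w.γ ≤ ½`; present in the consequent ∕ rung-2 forms only) stay the closer's — at `w.γ = γ`, `w.b = b`, `w.βup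 = β'` they ARE the K0 box `hbox ∕ hbox'` transferred to the window edition's β by dag-n21-c `betaLowerH∕betaUpperH_theta13OfThm1CCMW_of_half hγh`.) -/
theorem N24_betaWindowAtSomeRecord₁₃SepCoPH_of_rebindX_fourPin_pointed_of_boxH_theta13OfThm1CCMW_cube_of_prop8TopStep_of_prop6Member_of_betaBox_door (hm : 4 ≤ F.m) {B₃ a₀ a₁ B₁ c₁ B₃' a₁' : ℝ} (hB₃ : 2 * (F.L : ℝ) ^ 2 ≤ B₃) (ha₀ : 0 < a₀)
    (h8 : Prop8RegSepTopStepGB F 2 (fun ν K Ω => suppDomOfRecord F ν K Ω) (floorGuard F ((11 * 4 + 3 * F.L) * F.L)) (lamDatum F) (dataSmall7PTopOf F 2) B₃ a₀ a₁) (hB₁ : 0 ≤ B₁) (hc₁ : 0 < c₁)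
    (hP6 : letI : CStarAlgebra (MatA 2) := {}; B8.Prop6Printed 4 (F.L : ℝ) B₁ c₁ (fun i : B8LeafModelZd.ZdIdx 4 F.L => zdCub (MatA 2) F.L i))
    (hB₉ : b9Of F (F.L ^ 3) B₁ * B₃ ≤ B₃') (ha₁' : 0 < a₁') (ha₁'le : a₁' ≤ min a₁ (a0Of F 2 (F.L ^ 3) B₁ c₁ / B₃))
    {γ ε₀ ε₂₉ : ℝ} (hγ₀ : 0 < γ) (hγh : γ ≤ 1 / 2) (hε : 0 < ε₀) (hε' : 0 < ε₂₉) {b β' : ℝ} (hb : 0 ≤ b) (hbox : BetaLowerH b γ (betaOfRecord₁₃ F 2 (theta13OfThm1CCM F 2 3 ε₀ ε₂₉ B₃ B₃' a₀ a₁')))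
    (hbox' : BetaUpperH β' γ (betaOfRecord₁₃ F 2 (theta13OfThm1CCM F 2 3 ε₀ ε₂₉ B₃ B₃' a₀ a₁'))) (hβ' : β' * γ ^ 2 ≤ 3 / 4)
    (X' : B12.RunParams → PrintedCarriersR)
    (Mstar : ℕ)
    (ops : OpsY 2 (theta13OfThm1CCMW F 2 3 γ ε₀ ε₂₉ B₃ B₃' a₀ a₁').toStage3Params Mstar)
    (ζ : ResidZ F 2)
    (lamW : ResidW F 2)
    (w : WorldP)
    (hC : w.C = (datumOfRecord₁₃SepCoPH F 2 (Stage13HParams.ofHistoryBlind F 2 ⟨theta13OfThm1CCMW F 2 3 γ ε₀ ε₂₉ B₃ B₃' a₀ a₁', ZrOfRecord₁₃ F 2 (theta13OfThm1CCMW F 2 3 γ ε₀ ε₂₉ B₃ B₃' a₀ a₁')⟩) (N24_provisos₁₃SepCoPH_door_theta13OfThm1CCMW_cube_of_prop8TopStep_of_prop6Member_of_betaBoxW F hm hB₃ ha₀ h8 hB₁ hc₁ hP6 hB₉ ha₁' ha₁'le hγ₀ hγh hε hε' hb hbox hbox' hβ')).C)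
    (hγ : 0 < w.γ ∧ w.γ ≤ (theta13OfThm1CCMW F 2 3 γ ε₀ ε₂₉ B₃ B₃' a₀ a₁').γ)
    (hL : w.L = ((theta13OfThm1CCMW F 2 3 γ ε₀ ε₂₉ B₃ B₃' a₀ a₁').L : ℝ))
    (hup : ∀ P, w.up P = upOfRecord₅C F 2 (((Stage13HParams.ofHistoryBlind F 2 ⟨theta13OfThm1CCMW F 2 3 γ ε₀ ε₂₉ B₃ B₃' a₀ a₁', ZrOfRecord₁₃ F 2 (theta13OfThm1CCMW F 2 3 γ ε₀ ε₂₉ B₃ B₃' a₀ a₁')⟩).rebindX F 2 X').view₁₃CoPHB10YZW F 2 Mstar ops ζ lamW) P)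
    (h05 : ∀ P : B12.RunParams,
      B8LeafR (X' P).d8 (X' P).L8 (X' P).C₂ (X' P).B₁' (X' P).B₀' (X' P).B₁ (X' P).B₂ (X' P).c₁
        (X' P).inp8 (X' P).B₀β (X' P).loc8 (X' P).fam8R (X' P).lan8 (X' P).cub8 (X' P).toAxial8)
    (h06 : B9LeafX (Y9OfRecord 2 (theta13OfThm1CCMW F 2 3 γ ε₀ ε₂₉ B₃ B₃' a₀ a₁').toStage3Params Mstar ops))
    (h07 : B11Leaf (Z11OfRecord F 2 ζ))
    (h08 : PrintedUV3V 2 (theta13OfThm1CCMW F 2 3 γ ε₀ ε₂₉ B₃ B₃' a₀ a₁').L)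
    (h09 : ∀ P : B12.RunParams, B12Sec2to5.Lemma4Printed (X' P).F12 (X' P).c12)
    (h09T : ∀ P : B12.RunParams, (leavesP w P).smallCouplings → (leavesP w P).smallFieldInductive)
    (h10 : ∀ P : B12.RunParams, B9LeafX (Y9OfRecord 2 (theta13OfThm1CCMW F 2 3 γ ε₀ ε₂₉ B₃ B₃' a₀ a₁').toStage3Params Mstar ops) →
      (B10.Thm1PrintedCompact ((((Stage13HParams.ofHistoryBlind F 2 ⟨theta13OfThm1CCMW F 2 3 γ ε₀ ε₂₉ B₃ B₃' a₀ a₁', ZrOfRecord₁₃ F 2 (theta13OfThm1CCMW F 2 3 γ ε₀ ε₂₉ B₃ B₃' a₀ a₁')⟩).rebindX F 2 X').view₁₃CoPHB10YZW F 2 Mstar ops ζ lamW).res.X P).runs10 ∧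
          B10.Thm2Printed ((((Stage13HParams.ofHistoryBlind F 2 ⟨theta13OfThm1CCMW F 2 3 γ ε₀ ε₂₉ B₃ B₃' a₀ a₁', ZrOfRecord₁₃ F 2 (theta13OfThm1CCMW F 2 3 γ ε₀ ε₂₉ B₃ B₃' a₀ a₁')⟩).rebindX F 2 X').view₁₃CoPHB10YZW F 2 Mstar ops ζ lamW).res.X P).runs10) →
        B11Leaf (Z11OfRecord F 2 ζ) → B12Sec2to5.Lemma4Printed (X' P).F12 (X' P).c12 →
          B13.Lemma1Printed (X' P).S13 (X' P).c13 ∧ B13.Lemma2Printed (X' P).S13 (X' P).c13 ∧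
            B13.Lemma3Printed (X' P).S13 (X' P).c13)
    (h11 : ∀ P : B12.RunParams, (leavesP w P).b7 → (leavesP w P).b8 → (leavesP w P).b9 → (leavesP w P).b10 → (leavesP w P).b11 →
      (leavesP w P).smallCouplings → (leavesP w P).smallFieldInductive → (leavesP w P).flowControl →
        ∀ k, k < P.K → SLaw₁₃CoPH F 2 (Stage13HParams.ofHistoryBlind F 2 ⟨theta13OfThm1CCMW F 2 3 γ ε₀ ε₂₉ B₃ B₃' a₀ a₁', ZrOfRecord₁₃ F 2 (theta13OfThm1CCMW F 2 3 γ ε₀ ε₂₉ B₃ B₃' a₀ a₁')⟩) P k → TLaw₁₃CoPH F 2 (Stage13HParams.ofHistoryBlind F 2 ⟨theta13OfThm1CCMW F 2 3 γ ε₀ ε₂₉ B₃ B₃' a₀ a₁', ZrOfRecord₁₃ F 2 (theta13OfThm1CCMW F 2 3 γ ε₀ ε₂₉ B₃ B₃' a₀ a₁')⟩) P k)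
    (h12 : ∀ P : B12.RunParams, B15Leaf (WOfRecord₁₃ F 2 (theta13OfThm1CCMW F 2 3 γ ε₀ ε₂₉ B₃ B₃' a₀ a₁') lamW P))
    (hUV : ∀ P : B12.RunParams, (genFlow (betaOfRecord₁₃ F 2 (theta13OfThm1CCMW F 2 3 γ ε₀ ε₂₉ B₃ B₃' a₀ a₁')) P.g0).InInterval w.γ P.K → ∀ k, k ≤ P.K → SLaw₁₃CoPH F 2 (Stage13HParams.ofHistoryBlind F 2 ⟨theta13OfThm1CCMW F 2 3 γ ε₀ ε₂₉ B₃ B₃' a₀ a₁', ZrOfRecord₁₃ F 2 (theta13OfThm1CCMW F 2 3 γ ε₀ ε₂₉ B₃ B₃' a₀ a₁')⟩) P k →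
      ∀ U : GaugeField (F.P P.K) k (SU 2),
        chiβOfRecord₁₃ F 2 (theta13OfThm1CCMW F 2 3 γ ε₀ ε₂₉ B₃ B₃' a₀ a₁') P.K (gOfRecord₁₃ F 2 (theta13OfThm1CCMW F 2 3 γ ε₀ ε₂₉ B₃ B₃' a₀ a₁') P) k U *
              Real.exp (-(1 / (gOfRecord₁₃ F 2 (theta13OfThm1CCMW F 2 3 γ ε₀ ε₂₉ B₃ B₃' a₀ a₁') P k) ^ 2 * wilsonBGOfRecord F 2 (theta13OfThm1CCMW F 2 3 γ ε₀ ε₂₉ B₃ B₃' a₀ a₁').εbg P k U)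
                - w.em (gOfRecord₁₃ F 2 (theta13OfThm1CCMW F 2 3 γ ε₀ ε₂₉ B₃ B₃' a₀ a₁') P k) * (Fintype.card (Site (F.P P.K) k) : ℝ)) ≤ densOfRecord₁₃ F 2 (theta13OfThm1CCMW F 2 3 γ ε₀ ε₂₉ B₃ B₃' a₀ a₁') P k U ∧
        densOfRecord₁₃ F 2 (theta13OfThm1CCMW F 2 3 γ ε₀ ε₂₉ B₃ B₃' a₀ a₁') P k U ≤ Real.exp (w.ep (gOfRecord₁₃ F 2 (theta13OfThm1CCMW F 2 3 γ ε₀ ε₂₉ B₃ B₃' a₀ a₁') P k) * (Fintype.card (Site (F.P P.K) k) : ℝ)))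
    (hlo : BetaLowerH w.b w.γ (betaOfRecord₁₃ F 2 (theta13OfThm1CCMW F 2 3 γ ε₀ ε₂₉ B₃ B₃' a₀ a₁')))
    (hhi : BetaUpperH w.βup w.γ (betaOfRecord₁₃ F 2 (theta13OfThm1CCMW F 2 3 γ ε₀ ε₂₉ B₃ B₃' a₀ a₁'))) :
    ∃ (θ' : Stage13HParams F 2) (h' : θ'.Provisos₁₃SepCoPH F 2) (w' : WorldP), (θ'.ZhUnity F 2 ∧ θ'.SlotsNondegenerate₁₃ F 2) ∧ θ'.Admissible F 2 ∧
      IsRecordOfRecord₁₃CSepCoPH F 2 (datumOfRecord₁₃SepCoPH F 2 θ' h') w' ∧ (∀ P : B12.RunParams, Nodes (leavesP w' P)) ∧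
      BetaBoundsInInterval w'.C.toB12 w'.γ w'.b w'.βup ∧
      ∃ γ₁ : ℝ, 0 < γ₁ ∧ ∀ γ : ℝ, 0 < γ → γ ≤ γ₁ → ∃ P : B12.RunParams, 1 ≤ P.K ∧ ((datumOfRecord₁₃SepCoPH F 2 θ' h').C P).flow.InInterval γ P.K := by
  have hL0 : (0 : ℝ) < (F.L : ℝ) := by exact_mod_cast lt_trans Nat.zero_lt_one F.hL.2
  have hBpos : (0 : ℝ) < B₃ := lt_of_lt_of_le (mul_pos two_pos (pow_pos hL0 2)) hB₃
  have hB9 : (0 : ℝ) ≤ B₃' := (mul_nonneg (b9Of_pos (F := F) (F.L ^ 3) hB₁).le hBpos.le).trans hB₉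
  exact N24_betaWindowAtSomeRecord₁₃SepCoPH_of_rebindX_fourPin_pointed_of_boxH_theta13OfThm1CCMW_door (F := F) (N := 2) hγ₀ hγh hε hε' hBpos.le hB9 ha₀ ha₁' (N24_provisos₁₃SepCoPH_door_theta13OfThm1CCMW_cube_of_prop8TopStep_of_prop6Member_of_betaBoxW F hm hB₃ ha₀ h8 hB₁ hc₁ hP6 hB₉ ha₁' ha₁'le hγ₀ hγh hε hε' hb hbox hbox' hβ') X' Mstar ops ζ lamW w hC hγ hL hup h05 h06 h07 h08 h09 h09T h10 h11 h12 hUV hlo hhi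

/-- **AT THE V16 WITNESS ON PRINT's RANGE `4 ≤ F.m`, `N = 2`, `j = 3`, WITH `hP` DISCHARGED MODULO EXACTLY plan g77's V16 STUB BODIES** — [15] Prop. 8's top step `Prop8RegSepTopStepGB F 2 suppDom (floorGuard F ((11·4+3·L)·L)) (lamDatum F) (dataSmall7PTopOf F 2) B₃ a₀ a₁` with `2L² ≤ B₃`, `0 < a₀`, `0 < a₁` (stub 1 `Prop8StepCoPAt F` opened), [6] Prop. 6 at NODE 00's member `B8.Prop6Printed 4 L B₁ c₁ (zdCub (MatA 2) L ·)` with `0 ≤ B₁`, `0 < c₁` (stub 2 `Prop6MemberB8At F` opened), the window `0 < γ ≤ ½`, the thresholds `0 < ε₀`, `0 < ε₂₉` and stub 3ʷ's WINDOWED β-box `BetaLowerH b γ ∕ BetaUpperH β' γ` (`0 ≤ b`, `β'·γ² ≤ ¾`) of the β OF RECORD OF V15's WITNESS `betaOfRecord₁₃ F 2 θ₁₅ᶜᶜᴹ(3; ε₀, ε₂₉; B₃, B₃', a₀, a₁')` (= the window edition's on the box, dag-n21-c `betaLowerH∕betaUpperH_theta13OfThm1CCMW_of_half`) for ANY gauge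 constant `B₃' ≥ b9Of·B₃` and ceiling `0 < a₁' ≤ min a₁ (a0Of∕B₃)` (V16's exact letters with `le_rfl`) and `hm : 4 ≤ F.m` ((δ)); door provisos BY NAME (§0) through dag-n07-e's bridge, FILE C's window-blind `gauge9R_cube_of_prop8TopStep_of_prop6Member`, B′'s `.mono ∕ .of_le`, A2ʷ's `_half` history lemmas and FILE Bʷ's pointed provisos — AT THE V16 WITNESS SHAPE `Stage13HParams.ofHistoryBlind ⟨θ₁₅ᶜᶜᴹᵂ, ZrOfRecord₁₃ θ₁₅ᶜᶜᴹᵂ⟩` (the history-blind door over the cured residual of the windowed collared `θ₁₅ᶜᶜᴹᵂ(j; γ) = theta13OfThm1CCMW F N j γ ε₀ ε₂₉ B₃ B₃' a₀ a₁`, `0 < γ ≤ ½`; `= ofHistoryBlind (Stage13RParams.ofCured θ₁₅ᶜᶜᴹᵂ)`, `rfl`) — ★ ITEM K1⁷ (stmt-QuantumFields-20542)'s θ-KEYED CONSEQUENT, WITNESSED BY `(θ, hP)`, FROM THE POINTED CHILDREN ON N05's SURVIVING ROUTE** — the world S-bound to the four-pin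
view of the H-pinned parameter, N05 ← the repaired surviving slot; (B) by the previous theorem at `hP.toCore` (datum bridge `rfl`), window by module 26.
COMPOSITE: nothing is discharged. [cite: Balaban1989LargeFieldII, Thm 1 p.355, (0.1) pp.355–356, p.391; Balaban1985RegularSpaces, Thm 8 (1.146) p.101; Balaban1987RG1, Thm 3 p.264, (0.17)–(0.20) pp.255–256 and (1.22) p.264; Balaban1985UV3, Thm 1 p.257 (bookkeeping + elementary window)] (= `N24_stabilityBR13SepCoPH_thetaShape20_pinX3HS_fourPin_pointed` at `θ := the door`; `Admissible` ← dag-n21-c `admissible_theta13OfThm1CCMW_of_le_half` (window + six signs), `SlotsNondegenerate₁₃` ← dag-n21-c `slotsNondegenerate₁₃_theta13OfThm1CCMW` (hypothesis-free), N13's (R₁₃) ← §0 `N24_laws₁₃CoPH_theta13OfThm1CCMW` (= dag-n11-e's generic `rOpLeaf_VOfRecord₁₃CoPH_theta13LiveOfNumerics` at the member) — ALL BY NAME; the β-box pair `hlo ∕ hhi` read at the witness's β of record `betaOfRecord₁₃ F N θ₁₅ᶜᶜᴹᵂ` (def-T `βfun_datumOfRecord₁₃SepCoPH`, `rfl`)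 = the currency of V16's stub 3ʷ (there at `j = 3` on the window `γ = θ₁₅ᶜᶜᴹᵂ.γ`, so the world takes `w.γ ≤ γ`); the unity guard DISCHARGED by `Stage13RParams.ZrUnity.ofHistoryBlind` over K0a FILE 17 `finsum_ζ0_ZrOfRecord₁₃`; `hP : (…).Provisos₁₃SepCoPH F N` at the door — the K0⁷ skeleton's own product — is the ONLY K0-side hypothesis left.) (= `N24_stabilityBR13SepCoPH_thetaShape20_pinX3HS_fourPin_pointed_theta13OfThm1CCMW_door` with `hP := §0`; signs `0 ≤ B₃` from the floor, `0 ≤ B₃'` from `0 ≤ b9Of·B₃ ≤ B₃'` (`b9Of_pos`); the WORLD's β-box letters `hlo ∕ hhi` (at `w.b`, `w.βup`, `w.γ ≤ ½`; present in the consequent ∕ rung-2 forms only) stay the closer's — at `w.γ = γ`, `w.b = b`, `w.βup = β'` they ARE the K0 box `hbox ∕ hbox'` transferred to the window edition's β by dag-n21-c `betaLowerH∕betaUpperH_theta13OfThm1CCMW_of_half hγh`.) -/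
theorem N24_stabilityBR13SepCoPH_thetaShape20_pinX3HS_fourPin_pointed_theta13OfThm1CCMW_cube_of_prop8TopStep_of_prop6Member_of_betaBox_door (hm : 4 ≤ F.m) {B₃ a₀ a₁ B₁ c₁ B₃' a₁' : ℝ} (hB₃ : 2 * (F.L : ℝ) ^ 2 ≤ B₃) (ha₀ : 0 < a₀)
    (h8 : Prop8RegSepTopStepGB F 2 (fun ν K Ω => suppDomOfRecord F ν K Ω) (floorGuard F ((11 * 4 + 3 * F.L) * F.L)) (lamDatum F) (dataSmall7PTopOf F 2) B₃ a₀ a₁) (hB₁ : 0 ≤ B₁) (hc₁ : 0 < c₁)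
    (hP6 : letI : CStarAlgebra (MatA 2) := {}; B8.Prop6Printed 4 (F.L : ℝ) B₁ c₁ (fun i : B8LeafModelZd.ZdIdx 4 F.L => zdCub (MatA 2) F.L i))
    (hB₉ : b9Of F (F.L ^ 3) B₁ * B₃ ≤ B₃') (ha₁' : 0 < a₁') (ha₁'le : a₁' ≤ min a₁ (a0Of F 2 (F.L ^ 3) B₁ c₁ / B₃))
    {γ ε₀ ε₂₉ : ℝ} (hγ₀ : 0 < γ) (hγh : γ ≤ 1 / 2) (hε : 0 < ε₀) (hε' : 0 < ε₂₉) {b β' : ℝ} (hb : 0 ≤ b) (hbox : BetaLowerH b γ (betaOfRecord₁₃ F 2 (theta13OfThm1CCM F 2 3 ε₀ ε₂₉ B₃ B₃' a₀ a₁')))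
    (hbox' : BetaUpperH β' γ (betaOfRecord₁₃ F 2 (theta13OfThm1CCM F 2 3 ε₀ ε₂₉ B₃ B₃' a₀ a₁'))) (hβ' : β' * γ ^ 2 ≤ 3 / 4)
    (lam8 : ResidB8 (theta13OfThm1CCMW F 2 3 γ ε₀ ε₂₉ B₃ B₃' a₀ a₁').toStage3Params)
    (lam12 : ResidB12 F 2 (theta13OfThm1CCMW F 2 3 γ ε₀ ε₂₉ B₃ B₃' a₀ a₁').τ9.M)
    (lam13 : B12.RunParams → ResidB13 (theta13OfThm1CCMW F 2 3 γ ε₀ ε₂₉ B₃ B₃' a₀ a₁').toStage3Params)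
    (Mstar : ℕ)
    (ops : OpsY 2 (theta13OfThm1CCMW F 2 3 γ ε₀ ε₂₉ B₃ B₃' a₀ a₁').toStage3Params Mstar)
    (ζ : ResidZ F 2)
    (lamW : ResidW F 2)
    (w : WorldP)
    (hC : w.C = (datumOfRecord₁₃SepCoPH F 2 (Stage13HParams.ofHistoryBlind F 2 ⟨theta13OfThm1CCMW F 2 3 γ ε₀ ε₂₉ B₃ B₃' a₀ a₁', ZrOfRecord₁₃ F 2 (theta13OfThm1CCMW F 2 3 γ ε₀ ε₂₉ B₃ B₃' a₀ a₁')⟩) (N24_provisos₁₃SepCoPH_door_theta13OfThm1CCMW_cube_of_prop8TopStep_of_prop6Member_of_betaBoxW F hm hB₃ ha₀ h8 hB₁ hc₁ hP6 hB₉ ha₁' ha₁'le hγ₀ hγh hε hε' hb hbox hbox' hβ')).C)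
    (hγ : 0 < w.γ ∧ w.γ ≤ (theta13OfThm1CCMW F 2 3 γ ε₀ ε₂₉ B₃ B₃' a₀ a₁').γ)
    (hL : w.L = ((theta13OfThm1CCMW F 2 3 γ ε₀ ε₂₉ B₃ B₃' a₀ a₁').L : ℝ))
    (hup : ∀ P, w.up P = upOfRecord₅CS F 2 (((Stage13HParams.ofHistoryBlind F 2 ⟨theta13OfThm1CCMW F 2 3 γ ε₀ ε₂₉ B₃ B₃' a₀ a₁', ZrOfRecord₁₃ F 2 (theta13OfThm1CCMW F 2 3 γ ε₀ ε₂₉ B₃ B₃' a₀ a₁')⟩).pinX3H F 2 lam8 lam12 lam13).view₁₃CoPHB10YZW F 2 Mstar ops ζ lamW) P)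
    (h05 : B8LeafOfRecordSubBH (theta13OfThm1CCMW F 2 3 γ ε₀ ε₂₉ B₃ B₃' a₀ a₁').toStage3Params lam8)
    (h06 : B9LeafX (Y9OfRecord 2 (theta13OfThm1CCMW F 2 3 γ ε₀ ε₂₉ B₃ B₃' a₀ a₁').toStage3Params Mstar ops))
    (h07 : B11Leaf (Z11OfRecord F 2 ζ))
    (h08 : PrintedUV3V 2 (theta13OfThm1CCMW F 2 3 γ ε₀ ε₂₉ B₃ B₃' a₀ a₁').L)
    (h09 : ∀ P : B12.RunParams, B12Sec2to5.Lemma4Printed (F12OfRecord₁₂ F 2 (theta13OfThm1CCMW F 2 3 γ ε₀ ε₂₉ B₃ B₃' a₀ a₁').toStage12Params lam12 P) (lam12 P).consts)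
    (h09T : ∀ P : B12.RunParams, (leavesP w P).smallCouplings → (leavesP w P).smallFieldInductive)
    (h10 : ∀ P : B12.RunParams, B13LeafOfRecord (theta13OfThm1CCMW F 2 3 γ ε₀ ε₂₉ B₃ B₃' a₀ a₁').toStage3Params (lam13 P))
    (h11 : ∀ P : B12.RunParams, (leavesP w P).b7 → (leavesP w P).b8 → (leavesP w P).b9 → (leavesP w P).b10 → (leavesP w P).b11 →
      (leavesP w P).smallCouplings → (leavesP w P).smallFieldInductive → (leavesP w P).flowControl →
        ∀ k, k < P.K → SLaw₁₃CoPH F 2 (Stage13HParams.ofHistoryBlind F 2 ⟨theta13OfThm1CCMW F 2 3 γ ε₀ ε₂₉ B₃ B₃' a₀ a₁', ZrOfRecord₁₃ F 2 (theta13OfThm1CCMW F 2 3 γ ε₀ ε₂₉ B₃ B₃' a₀ a₁')⟩) P k → TLaw₁₃CoPH F 2 (Stage13HParams.ofHistoryBlind F 2 ⟨theta13OfThm1CCMW F 2 3 γ ε₀ ε₂₉ B₃ B₃' a₀ a₁', ZrOfRecord₁₃ F 2 (theta13OfThm1CCMW F 2 3 γ ε₀ ε₂₉ B₃ B₃' a₀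 a₁')⟩) P k)
    (h12 : ∀ P : B12.RunParams, B15Leaf (WOfRecord₁₃ F 2 (theta13OfThm1CCMW F 2 3 γ ε₀ ε₂₉ B₃ B₃' a₀ a₁') lamW P))
    (hUV : ∀ P : B12.RunParams, (genFlow (betaOfRecord₁₃ F 2 (theta13OfThm1CCMW F 2 3 γ ε₀ ε₂₉ B₃ B₃' a₀ a₁')) P.g0).InInterval w.γ P.K → ∀ k, k ≤ P.K → SLaw₁₃CoPH F 2 (Stage13HParams.ofHistoryBlind F 2 ⟨theta13OfThm1CCMW F 2 3 γ ε₀ ε₂₉ B₃ B₃' a₀ a₁', ZrOfRecord₁₃ F 2 (theta13OfThm1CCMW F 2 3 γ ε₀ ε₂₉ B₃ B₃' a₀ a₁')⟩) P k →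
      ∀ U : GaugeField (F.P P.K) k (SU 2),
        chiβOfRecord₁₃ F 2 (theta13OfThm1CCMW F 2 3 γ ε₀ ε₂₉ B₃ B₃' a₀ a₁') P.K (gOfRecord₁₃ F 2 (theta13OfThm1CCMW F 2 3 γ ε₀ ε₂₉ B₃ B₃' a₀ a₁') P) k U *
              Real.exp (-(1 / (gOfRecord₁₃ F 2 (theta13OfThm1CCMW F 2 3 γ ε₀ ε₂₉ B₃ B₃' a₀ a₁') P k) ^ 2 * wilsonBGOfRecord F 2 (theta13OfThm1CCMW F 2 3 γ ε₀ ε₂₉ B₃ B₃' a₀ a₁').εbg P k U)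
                - w.em (gOfRecord₁₃ F 2 (theta13OfThm1CCMW F 2 3 γ ε₀ ε₂₉ B₃ B₃' a₀ a₁') P k) * (Fintype.card (Site (F.P P.K) k) : ℝ)) ≤ densOfRecord₁₃ F 2 (theta13OfThm1CCMW F 2 3 γ ε₀ ε₂₉ B₃ B₃' a₀ a₁') P k U ∧
        densOfRecord₁₃ F 2 (theta13OfThm1CCMW F 2 3 γ ε₀ ε₂₉ B₃ B₃' a₀ a₁') P k U ≤ Real.exp (w.ep (gOfRecord₁₃ F 2 (theta13OfThm1CCMW F 2 3 γ ε₀ ε₂₉ B₃ B₃' a₀ a₁') P k) * (Fintype.card (Site (F.P P.K) k) : ℝ)))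
    (hlo : BetaLowerH w.b w.γ (betaOfRecord₁₃ F 2 (theta13OfThm1CCMW F 2 3 γ ε₀ ε₂₉ B₃ B₃' a₀ a₁')))
    (hhi : BetaUpperH w.βup w.γ (betaOfRecord₁₃ F 2 (theta13OfThm1CCMW F 2 3 γ ε₀ ε₂₉ B₃ B₃' a₀ a₁'))) :
    ∃ (θ' : Stage13HParams F 2) (h' : θ'.Provisos₁₃SepCoPH F 2), (θ'.ZhUnity F 2 ∧ θ'.SlotsNondegenerate₁₃ F 2) ∧ θ'.Admissible F 2 ∧
      B16.EndStatementBPrinted (datumOfRecord₁₃SepCoPH F 2 θ' h').C ∧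
      ∃ γ₁ : ℝ, 0 < γ₁ ∧ ∀ γ : ℝ, 0 < γ → γ ≤ γ₁ → ∃ P : B12.RunParams, 1 ≤ P.K ∧ ((datumOfRecord₁₃SepCoPH F 2 θ' h').C P).flow.InInterval γ P.K := by
  have hL0 : (0 : ℝ) < (F.L : ℝ) := by exact_mod_cast lt_trans Nat.zero_lt_one F.hL.2
  have hBpos : (0 : ℝ) < B₃ := lt_of_lt_of_le (mul_pos two_pos (pow_pos hL0 2)) hB₃
  have hB9 : (0 : ℝ) ≤ B₃' := (mul_nonneg (b9Of_pos (F := F) (F.L ^ 3) hB₁).le hBpos.le).trans hB₉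
  exact N24_stabilityBR13SepCoPH_thetaShape20_pinX3HS_fourPin_pointed_theta13OfThm1CCMW_door (F := F) (N := 2) hγ₀ hγh hε hε' hBpos.le hB9 ha₀ ha₁' (N24_provisos₁₃SepCoPH_door_theta13OfThm1CCMW_cube_of_prop8TopStep_of_prop6Member_of_betaBoxW F hm hB₃ ha₀ h8 hB₁ hc₁ hP6 hB₉ ha₁' ha₁'le hγ₀ hγh hε hε' hb hbox hbox' hβ') lam8 lam12 lam13 Mstar ops ζ lamW w hC hγ hL hup h05 h06 h07 h08 h09 h09T h10 h11 h12 hUV hlo hhi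

/-- **AT THE V16 WITNESS ON PRINT's RANGE `4 ≤ F.m`, `N = 2`, `j = 3`, WITH `hP` DISCHARGED MODULO EXACTLY plan g77's V16 STUB BODIES** — [15] Prop. 8's top step `Prop8RegSepTopStepGB F 2 suppDom (floorGuard F ((11·4+3·L)·L)) (lamDatum F) (dataSmall7PTopOf F 2) B₃ a₀ a₁` with `2L² ≤ B₃`, `0 < a₀`, `0 < a₁` (stub 1 `Prop8StepCoPAt F` opened), [6] Prop. 6 at NODE 00's member `B8.Prop6Printed 4 L B₁ c₁ (zdCub (MatA 2) L ·)` with `0 ≤ B₁`, `0 < c₁` (stub 2 `Prop6MemberB8At F` opened), the window `0 < γ ≤ ½`, the thresholds `0 < ε₀`, `0 < ε₂₉` and stub 3ʷ's WINDOWED β-box `BetaLowerH b γ ∕ BetaUpperH β' γ` (`0 ≤ b`, `β'·γ² ≤ ¾`) of the β OF RECORD OF V15's WITNESS `betaOfRecord₁₃ F 2 θ₁₅ᶜᶜᴹ(3; ε₀, ε₂₉; B₃, B₃', a₀, a₁')` (= the window edition's on the box, dag-n21-c `betaLowerH∕betaUpperH_theta13OfThm1CCMW_of_half`) for ANY gauge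 constant `B₃' ≥ b9Of·B₃` and ceiling `0 < a₁' ≤ min a₁ (a0Of∕B₃)` (V16's exact letters with `le_rfl`) and `hm : 4 ≤ F.m` ((δ)); door provisos BY NAME (§0) through dag-n07-e's bridge, FILE C's window-blind `gauge9R_cube_of_prop8TopStep_of_prop6Member`, B′'s `.mono ∕ .of_le`, A2ʷ's `_half` history lemmas and FILE Bʷ's pointed provisos — AT THE V16 WITNESS SHAPE `Stage13HParams.ofHistoryBlind ⟨θ₁₅ᶜᶜᴹᵂ, ZrOfRecord₁₃ θ₁₅ᶜᶜᴹᵂ⟩` (the history-blind door over the cured residual of the windowed collared `θ₁₅ᶜᶜᴹᵂ(j; γ) = theta13OfThm1CCMW F N j γ ε₀ ε₂₉ B₃ B₃' a₀ a₁`, `0 < γ ≤ ½`; `= ofHistoryBlind (Stage13RParams.ofCured θ₁₅ᶜᶜᴹᵂ)`, `rfl`) — RUNG 1's BODY AT dag-n05-d's H-PIN** (`X' := XPinned₁₃H θ λ₈ λ₁₂ λ₁₃`): N05 ← `B8LeafOfRecordSubBH θ₃ λ₈`, N09 ← Lemma 4 at `F12OfRecord₁₂ θ₁₂ λ₁₂`,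 N10 ← `B13LeafOfRecord θ₃ (λ₁₃ P)`
(the previous theorem through the three `Iff.rfl` sockets and §0's `b8` reading). [cite: Balaban1989LargeFieldII, Thm 1 p.355, (0.1) pp.355–356, p.391; Balaban1985RegularSpaces, Thm 8 (1.146) p.101; Balaban1985UV3, Thm 1 p.257 + Thm 2 p.272; Balaban1989LargeFieldI, Prop. 1 p.194; Balaban1987RG1, Thm 3 p.264, Lemma 4 p.280; Balaban1988RG2Cluster, Lemmas 1–3 pp.9–20 (bookkeeping)] (= `N24_nodesAtSomeRecordS₁₃SepCoPH_of_pinX3HS_fourPin_pointed` at `θ := the door`; `Admissible` ← dag-n21-c `admissible_theta13OfThm1CCMW_of_le_half` (window + six signs), `SlotsNondegenerate₁₃` ← dag-n21-c `slotsNondegenerate₁₃_theta13OfThm1CCMW` (hypothesis-free), N13's (R₁₃) ← §0 `N24_laws₁₃CoPH_theta13OfThm1CCMW` (= dag-n11-e's generic `rOpLeaf_VOfRecord₁₃CoPH_theta13LiveOfNumerics` at the member) — ALL BY NAME; the β-box pair `hlo ∕ hhi` read at the witness's β of record `betaOfRecord₁₃ F N θ₁₅ᶜᶜᴹᵂ`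 (def-T `βfun_datumOfRecord₁₃SepCoPH`, `rfl`) = the currency of V16's stub 3ʷ (there at `j = 3` on the window `γ = θ₁₅ᶜᶜᴹᵂ.γ`, so the world takes `w.γ ≤ γ`); the unity guard DISCHARGED by `Stage13RParams.ZrUnity.ofHistoryBlind` over K0a FILE 17 `finsum_ζ0_ZrOfRecord₁₃`; `hP : (…).Provisos₁₃SepCoPH F N` at the door — the K0⁷ skeleton's own product — is the ONLY K0-side hypothesis left.) (= `N24_nodesAtSomeRecordS₁₃SepCoPH_of_pinX3HS_fourPin_pointed_theta13OfThm1CCMW_door` with `hP := §0`; signs `0 ≤ B₃` from the floor, `0 ≤ B₃'` from `0 ≤ b9Of·B₃ ≤ B₃'` (`b9Of_pos`); the WORLD's β-box letters `hlo ∕ hhi` (at `w.b`, `w.βup`, `w.γ ≤ ½`; present in the consequent ∕ rung-2 forms only) stay the closer's — at `w.γ = γ`, `w.b = b`, `w.βup = β'` they ARE the K0 box `hbox ∕ hbox'` transferred to the window edition's β by dag-n21-c `betaLowerH∕betaUpperH_theta13OfThm1CCMW_of_half hγh`.) -/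
theorem N24_nodesAtSomeRecordS₁₃SepCoPH_of_pinX3HS_fourPin_pointed_theta13OfThm1CCMW_cube_of_prop8TopStep_of_prop6Member_of_betaBox_door (hm : 4 ≤ F.m) {B₃ a₀ a₁ B₁ c₁ B₃' a₁' : ℝ} (hB₃ : 2 * (F.L : ℝ) ^ 2 ≤ B₃) (ha₀ : 0 < a₀)
    (h8 : Prop8RegSepTopStepGB F 2 (fun ν K Ω => suppDomOfRecord F ν K Ω) (floorGuard F ((11 * 4 + 3 * F.L) * F.L)) (lamDatum F) (dataSmall7PTopOf F 2) B₃ a₀ a₁) (hB₁ : 0 ≤ B₁) (hc₁ : 0 < c₁)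
    (hP6 : letI : CStarAlgebra (MatA 2) := {}; B8.Prop6Printed 4 (F.L : ℝ) B₁ c₁ (fun i : B8LeafModelZd.ZdIdx 4 F.L => zdCub (MatA 2) F.L i))
    (hB₉ : b9Of F (F.L ^ 3) B₁ * B₃ ≤ B₃') (ha₁' : 0 < a₁') (ha₁'le : a₁' ≤ min a₁ (a0Of F 2 (F.L ^ 3) B₁ c₁ / B₃))
    {γ ε₀ ε₂₉ : ℝ} (hγ₀ : 0 < γ) (hγh : γ ≤ 1 / 2) (hε : 0 < ε₀) (hε' : 0 < ε₂₉) {b β' : ℝ} (hb : 0 ≤ b) (hbox : BetaLowerH b γ (betaOfRecord₁₃ F 2 (theta13OfThm1CCM F 2 3 ε₀ ε₂₉ B₃ B₃' a₀ a₁')))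
    (hbox' : BetaUpperH β' γ (betaOfRecord₁₃ F 2 (theta13OfThm1CCM F 2 3 ε₀ ε₂₉ B₃ B₃' a₀ a₁'))) (hβ' : β' * γ ^ 2 ≤ 3 / 4)
    (lam8 : ResidB8 (theta13OfThm1CCMW F 2 3 γ ε₀ ε₂₉ B₃ B₃' a₀ a₁').toStage3Params)
    (lam12 : ResidB12 F 2 (theta13OfThm1CCMW F 2 3 γ ε₀ ε₂₉ B₃ B₃' a₀ a₁').τ9.M)
    (lam13 : B12.RunParams → ResidB13 (theta13OfThm1CCMW F 2 3 γ ε₀ ε₂₉ B₃ B₃' a₀ a₁').toStage3Params)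
    (Mstar : ℕ)
    (ops : OpsY 2 (theta13OfThm1CCMW F 2 3 γ ε₀ ε₂₉ B₃ B₃' a₀ a₁').toStage3Params Mstar)
    (ζ : ResidZ F 2)
    (lamW : ResidW F 2)
    (w : WorldP)
    (hC : w.C = (datumOfRecord₁₃SepCoPH F 2 (Stage13HParams.ofHistoryBlind F 2 ⟨theta13OfThm1CCMW F 2 3 γ ε₀ ε₂₉ B₃ B₃' a₀ a₁', ZrOfRecord₁₃ F 2 (theta13OfThm1CCMW F 2 3 γ ε₀ ε₂₉ B₃ B₃' a₀ a₁')⟩) (N24_provisos₁₃SepCoPH_door_theta13OfThm1CCMW_cube_of_prop8TopStep_of_prop6Member_of_betaBoxW F hm hB₃ ha₀ h8 hB₁ hc₁ hP6 hB₉ ha₁' ha₁'le hγ₀ hγh hε hε' hb hbox hbox' hβ')).C)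
    (hγ : 0 < w.γ ∧ w.γ ≤ (theta13OfThm1CCMW F 2 3 γ ε₀ ε₂₉ B₃ B₃' a₀ a₁').γ)
    (hL : w.L = ((theta13OfThm1CCMW F 2 3 γ ε₀ ε₂₉ B₃ B₃' a₀ a₁').L : ℝ))
    (hup : ∀ P, w.up P = upOfRecord₅CS F 2 (((Stage13HParams.ofHistoryBlind F 2 ⟨theta13OfThm1CCMW F 2 3 γ ε₀ ε₂₉ B₃ B₃' a₀ a₁', ZrOfRecord₁₃ F 2 (theta13OfThm1CCMW F 2 3 γ ε₀ ε₂₉ B₃ B₃' a₀ a₁')⟩).pinX3H F 2 lam8 lam12 lam13).view₁₃CoPHB10YZW F 2 Mstar ops ζ lamW) P)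
    (h05 : B8LeafOfRecordSubBH (theta13OfThm1CCMW F 2 3 γ ε₀ ε₂₉ B₃ B₃' a₀ a₁').toStage3Params lam8)
    (h06 : B9LeafX (Y9OfRecord 2 (theta13OfThm1CCMW F 2 3 γ ε₀ ε₂₉ B₃ B₃' a₀ a₁').toStage3Params Mstar ops))
    (h07 : B11Leaf (Z11OfRecord F 2 ζ))
    (h08 : PrintedUV3V 2 (theta13OfThm1CCMW F 2 3 γ ε₀ ε₂₉ B₃ B₃' a₀ a₁').L)
    (h09 : ∀ P : B12.RunParams, B12Sec2to5.Lemma4Printed (F12OfRecord₁₂ F 2 (theta13OfThm1CCMW F 2 3 γ ε₀ ε₂₉ B₃ B₃' a₀ a₁').toStage12Params lam12 P) (lam12 P).consts)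
    (h09T : ∀ P : B12.RunParams, (leavesP w P).smallCouplings → (leavesP w P).smallFieldInductive)
    (h10 : ∀ P : B12.RunParams, B13LeafOfRecord (theta13OfThm1CCMW F 2 3 γ ε₀ ε₂₉ B₃ B₃' a₀ a₁').toStage3Params (lam13 P))
    (h11 : ∀ P : B12.RunParams, (leavesP w P).b7 → (leavesP w P).b8 → (leavesP w P).b9 → (leavesP w P).b10 → (leavesP w P).b11 →
      (leavesP w P).smallCouplings → (leavesP w P).smallFieldInductive → (leavesP w P).flowControl →
        ∀ k, k < P.K → SLaw₁₃CoPH F 2 (Stage13HParams.ofHistoryBlind F 2 ⟨theta13OfThm1CCMW F 2 3 γ ε₀ ε₂₉ B₃ B₃' a₀ a₁', ZrOfRecord₁₃ F 2 (theta13OfThm1CCMW F 2 3 γ ε₀ ε₂₉ B₃ B₃' a₀ a₁')⟩) P k → TLaw₁₃CoPH F 2 (Stage13HParams.ofHistoryBlind F 2 ⟨theta13OfThm1CCMW F 2 3 γ ε₀ ε₂₉ B₃ B₃' a₀ a₁', ZrOfRecord₁₃ F 2 (theta13OfThm1CCMW F 2 3 γ ε₀ ε₂₉ B₃ B₃' a₀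 a₁')⟩) P k)
    (h12 : ∀ P : B12.RunParams, B15Leaf (WOfRecord₁₃ F 2 (theta13OfThm1CCMW F 2 3 γ ε₀ ε₂₉ B₃ B₃' a₀ a₁') lamW P))
    (hUV : ∀ P : B12.RunParams, (genFlow (betaOfRecord₁₃ F 2 (theta13OfThm1CCMW F 2 3 γ ε₀ ε₂₉ B₃ B₃' a₀ a₁')) P.g0).InInterval w.γ P.K → ∀ k, k ≤ P.K → SLaw₁₃CoPH F 2 (Stage13HParams.ofHistoryBlind F 2 ⟨theta13OfThm1CCMW F 2 3 γ ε₀ ε₂₉ B₃ B₃' a₀ a₁', ZrOfRecord₁₃ F 2 (theta13OfThm1CCMW F 2 3 γ ε₀ ε₂₉ B₃ B₃' a₀ a₁')⟩) P k →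
      ∀ U : GaugeField (F.P P.K) k (SU 2),
        chiβOfRecord₁₃ F 2 (theta13OfThm1CCMW F 2 3 γ ε₀ ε₂₉ B₃ B₃' a₀ a₁') P.K (gOfRecord₁₃ F 2 (theta13OfThm1CCMW F 2 3 γ ε₀ ε₂₉ B₃ B₃' a₀ a₁') P) k U *
              Real.exp (-(1 / (gOfRecord₁₃ F 2 (theta13OfThm1CCMW F 2 3 γ ε₀ ε₂₉ B₃ B₃' a₀ a₁') P k) ^ 2 * wilsonBGOfRecord F 2 (theta13OfThm1CCMW F 2 3 γ ε₀ ε₂₉ B₃ B₃' a₀ a₁').εbg P k U)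
                - w.em (gOfRecord₁₃ F 2 (theta13OfThm1CCMW F 2 3 γ ε₀ ε₂₉ B₃ B₃' a₀ a₁') P k) * (Fintype.card (Site (F.P P.K) k) : ℝ)) ≤ densOfRecord₁₃ F 2 (theta13OfThm1CCMW F 2 3 γ ε₀ ε₂₉ B₃ B₃' a₀ a₁') P k U ∧
        densOfRecord₁₃ F 2 (theta13OfThm1CCMW F 2 3 γ ε₀ ε₂₉ B₃ B₃' a₀ a₁') P k U ≤ Real.exp (w.ep (gOfRecord₁₃ F 2 (theta13OfThm1CCMW F 2 3 γ ε₀ ε₂₉ B₃ B₃' a₀ a₁') P k) * (Fintype.card (Site (F.P P.K) k) : ℝ)))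
    (hK : ∀ P : B12.RunParams, 1 ≤ P.K → lamW.kSel P < P.K) :
    ∃ (θ : Stage13HParams F 2) (hP : θ.Provisos₁₃SepCoPH F 2) (w : WorldP), (θ.ZhUnity F 2 ∧ θ.SlotsNondegenerate₁₃ F 2) ∧ θ.Admissible F 2 ∧
      (∃ (θ' : Stage13HParams F 2) (h' : θ'.Provisos₁₃SepCoPH F 2), θ'.Admissible F 2 ∧
      datumOfRecord₁₃SepCoPH F 2 θ hP = datumOfRecord₁₃SepCoPH F 2 θ' h' ∧ w.C = (datumOfRecord₁₃SepCoPH F 2 θ hP).C ∧ (0 < w.γ ∧ w.γ ≤ θ'.γ) ∧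
      w.L = (θ'.L : ℝ) ∧ ∀ P : B12.RunParams, w.up P = upOfRecord₅CS F 2 (θ'.toStage5₁₃CoPH F 2) P) ∧
      (∀ P : B12.RunParams, Nodes (leavesP w P)) ∧ PrintedUV3V 2 θ.L ∧
      ∃ lam : ResidW F 2, (∀ P : B12.RunParams, 1 ≤ P.K → lam.kSel P < P.K) ∧
        ∀ P : B12.RunParams, lam.kSel P < P.K → ((leavesP w P).rBasicStep ↔ B15Leaf (WOfRecord₁₃ F 2 θ.toStage13Params lam P)) := by
  have hL0 : (0 : ℝ) < (F.L : ℝ) := by exact_mod_cast lt_trans Nat.zero_lt_one F.hL.2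
  have hBpos : (0 : ℝ) < B₃ := lt_of_lt_of_le (mul_pos two_pos (pow_pos hL0 2)) hB₃
  have hB9 : (0 : ℝ) ≤ B₃' := (mul_nonneg (b9Of_pos (F := F) (F.L ^ 3) hB₁).le hBpos.le).trans hB₉
  exact N24_nodesAtSomeRecordS₁₃SepCoPH_of_pinX3HS_fourPin_pointed_theta13OfThm1CCMW_door (F := F) (N := 2) hγ₀ hγh hε hε' hBpos.le hB9 ha₀ ha₁' (N24_provisos₁₃SepCoPH_door_theta13OfThm1CCMW_cube_of_prop8TopStep_of_prop6Member_of_betaBoxW F hm hB₃ ha₀ h8 hB₁ hc₁ hP6 hB₉ ha₁' ha₁'le hγ₀ hγh hε hε' hb hbox hbox' hβ') lam8 lam12 lam13 Mstar ops ζ lamW w hC hγ hL hup h05 h06 h07 h08 h09 h09T h10 h11 h12 hUV hK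

/-- **AT THE V16 WITNESS ON PRINT's RANGE `4 ≤ F.m`, `N = 2`, `j = 3`, WITH `hP` DISCHARGED MODULO EXACTLY plan g77's V16 STUB BODIES** — [15] Prop. 8's top step `Prop8RegSepTopStepGB F 2 suppDom (floorGuard F ((11·4+3·L)·L)) (lamDatum F) (dataSmall7PTopOf F 2) B₃ a₀ a₁` with `2L² ≤ B₃`, `0 < a₀`, `0 < a₁` (stub 1 `Prop8StepCoPAt F` opened), [6] Prop. 6 at NODE 00's member `B8.Prop6Printed 4 L B₁ c₁ (zdCub (MatA 2) L ·)` with `0 ≤ B₁`, `0 < c₁` (stub 2 `Prop6MemberB8At F` opened), the window `0 < γ ≤ ½`, the thresholds `0 < ε₀`, `0 < ε₂₉` and stub 3ʷ's WINDOWED β-box `BetaLowerH b γ ∕ BetaUpperH β' γ` (`0 ≤ b`, `β'·γ² ≤ ¾`) of the β OF RECORD OF V15's WITNESS `betaOfRecord₁₃ F 2 θ₁₅ᶜᶜᴹ(3; ε₀, ε₂₉; B₃, B₃', a₀, a₁')` (= the window edition's on the box, dag-n21-c `betaLowerH∕betaUpperH_theta13OfThm1CCMW_of_half`) for ANY gauge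 constant `B₃' ≥ b9Of·B₃` and ceiling `0 < a₁' ≤ min a₁ (a0Of∕B₃)` (V16's exact letters with `le_rfl`) and `hm : 4 ≤ F.m` ((δ)); door provisos BY NAME (§0) through dag-n07-e's bridge, FILE C's window-blind `gauge9R_cube_of_prop8TopStep_of_prop6Member`, B′'s `.mono ∕ .of_le`, A2ʷ's `_half` history lemmas and FILE Bʷ's pointed provisos — AT THE V16 WITNESS SHAPE `Stage13HParams.ofHistoryBlind ⟨θ₁₅ᶜᶜᴹᵂ, ZrOfRecord₁₃ θ₁₅ᶜᶜᴹᵂ⟩` (the history-blind door over the cured residual of the windowed collared `θ₁₅ᶜᶜᴹᵂ(j; γ) = theta13OfThm1CCMW F N j γ ε₀ ε₂₉ B₃ B₃' a₀ a₁`, `0 < γ ≤ ½`; `= ofHistoryBlind (Stage13RParams.ofCured θ₁₅ᶜᶜᴹᵂ)`, `rfl`) — RUNG 2's BODY AT dag-n05-d's H-PIN** (`X' := XPinned₁₃H θ λ₈ λ₁₂ λ₁₃`), from the pointed children on N05's surviving route and the β-box pair.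
[cite: Balaban1989LargeFieldII, Thm 1 p.355, (0.1) pp.355–356, p.391; Balaban1987RG1, Thm 3 p.264, (0.17)–(0.20) pp.255–256 and (1.22) p.264; Balaban1985RegularSpaces, Thm 8 (1.146) p.101 (bookkeeping + elementary window)] (= `N24_betaWindowAtSomeRecordS₁₃SepCoPH_of_pinX3HS_fourPin_pointed_of_boxH` at `θ := the door`; `Admissible` ← dag-n21-c `admissible_theta13OfThm1CCMW_of_le_half` (window + six signs), `SlotsNondegenerate₁₃` ← dag-n21-c `slotsNondegenerate₁₃_theta13OfThm1CCMW` (hypothesis-free), N13's (R₁₃) ← §0 `N24_laws₁₃CoPH_theta13OfThm1CCMW` (= dag-n11-e's generic `rOpLeaf_VOfRecord₁₃CoPH_theta13LiveOfNumerics` at the member) — ALL BY NAME; the β-box pair `hlo ∕ hhi` read at the witness's β of record `betaOfRecord₁₃ F N θ₁₅ᶜᶜᴹᵂ` (def-T `βfun_datumOfRecord₁₃SepCoPH`, `rfl`) = the currency of V16's stub 3ʷ (there at `j = 3` on the window `γ = θ₁₅ᶜᶜᴹᵂ.γ`, so the world takes `w.γ ≤ γ`); the unity guard DISCHARGED by `Stage13RParams.ZrUnity.ofHistoryBlind`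 over K0a FILE 17 `finsum_ζ0_ZrOfRecord₁₃`; `hP : (…).Provisos₁₃SepCoPH F N` at the door — the K0⁷ skeleton's own product — is the ONLY K0-side hypothesis left.) (= `N24_betaWindowAtSomeRecordS₁₃SepCoPH_of_pinX3HS_fourPin_pointed_of_boxH_theta13OfThm1CCMW_door` with `hP := §0`; signs `0 ≤ B₃` from the floor, `0 ≤ B₃'` from `0 ≤ b9Of·B₃ ≤ B₃'` (`b9Of_pos`); the WORLD's β-box letters `hlo ∕ hhi` (at `w.b`, `w.βup`, `w.γ ≤ ½`; present in the consequent ∕ rung-2 forms only) stay the closer's — at `w.γ = γ`, `w.b = b`, `w.βup = β'` they ARE the K0 box `hbox ∕ hbox'` transferred to the window edition's β by dag-n21-c `betaLowerH∕betaUpperH_theta13OfThm1CCMW_of_half hγh`.) -/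
theorem N24_betaWindowAtSomeRecordS₁₃SepCoPH_of_pinX3HS_fourPin_pointed_of_boxH_theta13OfThm1CCMW_cube_of_prop8TopStep_of_prop6Member_of_betaBox_door (hm : 4 ≤ F.m) {B₃ a₀ a₁ B₁ c₁ B₃' a₁' : ℝ} (hB₃ : 2 * (F.L : ℝ) ^ 2 ≤ B₃) (ha₀ : 0 < a₀)
    (h8 : Prop8RegSepTopStepGB F 2 (fun ν K Ω => suppDomOfRecord F ν K Ω) (floorGuard F ((11 * 4 + 3 * F.L) * F.L)) (lamDatum F) (dataSmall7PTopOf F 2) B₃ a₀ a₁) (hB₁ : 0 ≤ B₁) (hc₁ : 0 < c₁)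
    (hP6 : letI : CStarAlgebra (MatA 2) := {}; B8.Prop6Printed 4 (F.L : ℝ) B₁ c₁ (fun i : B8LeafModelZd.ZdIdx 4 F.L => zdCub (MatA 2) F.L i))
    (hB₉ : b9Of F (F.L ^ 3) B₁ * B₃ ≤ B₃') (ha₁' : 0 < a₁') (ha₁'le : a₁' ≤ min a₁ (a0Of F 2 (F.L ^ 3) B₁ c₁ / B₃))
    {γ ε₀ ε₂₉ : ℝ} (hγ₀ : 0 < γ) (hγh : γ ≤ 1 / 2) (hε : 0 < ε₀) (hε' : 0 < ε₂₉) {b β' : ℝ} (hb : 0 ≤ b) (hbox : BetaLowerH b γ (betaOfRecord₁₃ F 2 (theta13OfThm1CCM F 2 3 ε₀ ε₂₉ B₃ B₃' a₀ a₁')))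
    (hbox' : BetaUpperH β' γ (betaOfRecord₁₃ F 2 (theta13OfThm1CCM F 2 3 ε₀ ε₂₉ B₃ B₃' a₀ a₁'))) (hβ' : β' * γ ^ 2 ≤ 3 / 4)
    (lam8 : ResidB8 (theta13OfThm1CCMW F 2 3 γ ε₀ ε₂₉ B₃ B₃' a₀ a₁').toStage3Params)
    (lam12 : ResidB12 F 2 (theta13OfThm1CCMW F 2 3 γ ε₀ ε₂₉ B₃ B₃' a₀ a₁').τ9.M)
    (lam13 : B12.RunParams → ResidB13 (theta13OfThm1CCMW F 2 3 γ ε₀ ε₂₉ B₃ B₃' a₀ a₁').toStage3Params)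
    (Mstar : ℕ)
    (ops : OpsY 2 (theta13OfThm1CCMW F 2 3 γ ε₀ ε₂₉ B₃ B₃' a₀ a₁').toStage3Params Mstar)
    (ζ : ResidZ F 2)
    (lamW : ResidW F 2)
    (w : WorldP)
    (hC : w.C = (datumOfRecord₁₃SepCoPH F 2 (Stage13HParams.ofHistoryBlind F 2 ⟨theta13OfThm1CCMW F 2 3 γ ε₀ ε₂₉ B₃ B₃' a₀ a₁', ZrOfRecord₁₃ F 2 (theta13OfThm1CCMW F 2 3 γ ε₀ ε₂₉ B₃ B₃' a₀ a₁')⟩) (N24_provisos₁₃SepCoPH_door_theta13OfThm1CCMW_cube_of_prop8TopStep_of_prop6Member_of_betaBoxW F hm hB₃ ha₀ h8 hB₁ hc₁ hP6 hB₉ ha₁' ha₁'le hγ₀ hγh hε hε' hb hbox hbox' hβ')).C)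
    (hγ : 0 < w.γ ∧ w.γ ≤ (theta13OfThm1CCMW F 2 3 γ ε₀ ε₂₉ B₃ B₃' a₀ a₁').γ)
    (hL : w.L = ((theta13OfThm1CCMW F 2 3 γ ε₀ ε₂₉ B₃ B₃' a₀ a₁').L : ℝ))
    (hup : ∀ P, w.up P = upOfRecord₅CS F 2 (((Stage13HParams.ofHistoryBlind F 2 ⟨theta13OfThm1CCMW F 2 3 γ ε₀ ε₂₉ B₃ B₃' a₀ a₁', ZrOfRecord₁₃ F 2 (theta13OfThm1CCMW F 2 3 γ ε₀ ε₂₉ B₃ B₃' a₀ a₁')⟩).pinX3H F 2 lam8 lam12 lam13).view₁₃CoPHB10YZW F 2 Mstar ops ζ lamW) P)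
    (h05 : B8LeafOfRecordSubBH (theta13OfThm1CCMW F 2 3 γ ε₀ ε₂₉ B₃ B₃' a₀ a₁').toStage3Params lam8)
    (h06 : B9LeafX (Y9OfRecord 2 (theta13OfThm1CCMW F 2 3 γ ε₀ ε₂₉ B₃ B₃' a₀ a₁').toStage3Params Mstar ops))
    (h07 : B11Leaf (Z11OfRecord F 2 ζ))
    (h08 : PrintedUV3V 2 (theta13OfThm1CCMW F 2 3 γ ε₀ ε₂₉ B₃ B₃' a₀ a₁').L)
    (h09 : ∀ P : B12.RunParams, B12Sec2to5.Lemma4Printed (F12OfRecord₁₂ F 2 (theta13OfThm1CCMW F 2 3 γ ε₀ ε₂₉ B₃ B₃' a₀ a₁').toStage12Params lam12 P) (lam12 P).consts)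
    (h09T : ∀ P : B12.RunParams, (leavesP w P).smallCouplings → (leavesP w P).smallFieldInductive)
    (h10 : ∀ P : B12.RunParams, B13LeafOfRecord (theta13OfThm1CCMW F 2 3 γ ε₀ ε₂₉ B₃ B₃' a₀ a₁').toStage3Params (lam13 P))
    (h11 : ∀ P : B12.RunParams, (leavesP w P).b7 → (leavesP w P).b8 → (leavesP w P).b9 → (leavesP w P).b10 → (leavesP w P).b11 →
      (leavesP w P).smallCouplings → (leavesP w P).smallFieldInductive → (leavesP w P).flowControl →
        ∀ k, k < P.K → SLaw₁₃CoPH F 2 (Stage13HParams.ofHistoryBlind F 2 ⟨theta13OfThm1CCMW F 2 3 γ ε₀ ε₂₉ B₃ B₃' a₀ a₁', ZrOfRecord₁₃ F 2 (theta13OfThm1CCMW F 2 3 γ ε₀ ε₂₉ B₃ B₃' a₀ a₁')⟩) P k → TLaw₁₃CoPH F 2 (Stage13HParams.ofHistoryBlind F 2 ⟨theta13OfThm1CCMW F 2 3 γ ε₀ ε₂₉ B₃ B₃' a₀ a₁', ZrOfRecord₁₃ F 2 (theta13OfThm1CCMW F 2 3 γ ε₀ ε₂₉ B₃ B₃' a₀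 a₁')⟩) P k)
    (h12 : ∀ P : B12.RunParams, B15Leaf (WOfRecord₁₃ F 2 (theta13OfThm1CCMW F 2 3 γ ε₀ ε₂₉ B₃ B₃' a₀ a₁') lamW P))
    (hUV : ∀ P : B12.RunParams, (genFlow (betaOfRecord₁₃ F 2 (theta13OfThm1CCMW F 2 3 γ ε₀ ε₂₉ B₃ B₃' a₀ a₁')) P.g0).InInterval w.γ P.K → ∀ k, k ≤ P.K → SLaw₁₃CoPH F 2 (Stage13HParams.ofHistoryBlind F 2 ⟨theta13OfThm1CCMW F 2 3 γ ε₀ ε₂₉ B₃ B₃' a₀ a₁', ZrOfRecord₁₃ F 2 (theta13OfThm1CCMW F 2 3 γ ε₀ ε₂₉ B₃ B₃' a₀ a₁')⟩) P k →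
      ∀ U : GaugeField (F.P P.K) k (SU 2),
        chiβOfRecord₁₃ F 2 (theta13OfThm1CCMW F 2 3 γ ε₀ ε₂₉ B₃ B₃' a₀ a₁') P.K (gOfRecord₁₃ F 2 (theta13OfThm1CCMW F 2 3 γ ε₀ ε₂₉ B₃ B₃' a₀ a₁') P) k U *
              Real.exp (-(1 / (gOfRecord₁₃ F 2 (theta13OfThm1CCMW F 2 3 γ ε₀ ε₂₉ B₃ B₃' a₀ a₁') P k) ^ 2 * wilsonBGOfRecord F 2 (theta13OfThm1CCMW F 2 3 γ ε₀ ε₂₉ B₃ B₃' a₀ a₁').εbg P k U)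
                - w.em (gOfRecord₁₃ F 2 (theta13OfThm1CCMW F 2 3 γ ε₀ ε₂₉ B₃ B₃' a₀ a₁') P k) * (Fintype.card (Site (F.P P.K) k) : ℝ)) ≤ densOfRecord₁₃ F 2 (theta13OfThm1CCMW F 2 3 γ ε₀ ε₂₉ B₃ B₃' a₀ a₁') P k U ∧
        densOfRecord₁₃ F 2 (theta13OfThm1CCMW F 2 3 γ ε₀ ε₂₉ B₃ B₃' a₀ a₁') P k U ≤ Real.exp (w.ep (gOfRecord₁₃ F 2 (theta13OfThm1CCMW F 2 3 γ ε₀ ε₂₉ B₃ B₃' a₀ a₁') P k) * (Fintype.card (Site (F.P P.K) k) : ℝ)))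
    (hlo : BetaLowerH w.b w.γ (betaOfRecord₁₃ F 2 (theta13OfThm1CCMW F 2 3 γ ε₀ ε₂₉ B₃ B₃' a₀ a₁')))
    (hhi : BetaUpperH w.βup w.γ (betaOfRecord₁₃ F 2 (theta13OfThm1CCMW F 2 3 γ ε₀ ε₂₉ B₃ B₃' a₀ a₁'))) :
    ∃ (θ : Stage13HParams F 2) (hP : θ.Provisos₁₃SepCoPH F 2) (w : WorldP), (θ.ZhUnity F 2 ∧ θ.SlotsNondegenerate₁₃ F 2) ∧ θ.Admissible F 2 ∧
      (∃ (θ' : Stage13HParams F 2) (h' : θ'.Provisos₁₃SepCoPH F 2), θ'.Admissible F 2 ∧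
      datumOfRecord₁₃SepCoPH F 2 θ hP = datumOfRecord₁₃SepCoPH F 2 θ' h' ∧ w.C = (datumOfRecord₁₃SepCoPH F 2 θ hP).C ∧ (0 < w.γ ∧ w.γ ≤ θ'.γ) ∧
      w.L = (θ'.L : ℝ) ∧ ∀ P : B12.RunParams, w.up P = upOfRecord₅CS F 2 (θ'.toStage5₁₃CoPH F 2) P) ∧
      (∀ P : B12.RunParams, Nodes (leavesP w P)) ∧ BetaBoundsInInterval w.C.toB12 w.γ w.b w.βup ∧
      ∃ γ₁ : ℝ, 0 < γ₁ ∧ ∀ γ : ℝ, 0 < γ → γ ≤ γ₁ → ∃ P : B12.RunParams, 1 ≤ P.K ∧ ((datumOfRecord₁₃SepCoPH F 2 θ hP).C P).flow.InInterval γ P.K := by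
  have hL0 : (0 : ℝ) < (F.L : ℝ) := by exact_mod_cast lt_trans Nat.zero_lt_one F.hL.2
  have hBpos : (0 : ℝ) < B₃ := lt_of_lt_of_le (mul_pos two_pos (pow_pos hL0 2)) hB₃
  have hB9 : (0 : ℝ) ≤ B₃' := (mul_nonneg (b9Of_pos (F := F) (F.L ^ 3) hB₁).le hBpos.le).trans hB₉
  exact N24_betaWindowAtSomeRecordS₁₃SepCoPH_of_pinX3HS_fourPin_pointed_of_boxH_theta13OfThm1CCMW_door (F := F) (N := 2) hγ₀ hγh hε hε' hBpos.le hB9 ha₀ ha₁' (N24_provisos₁₃SepCoPH_door_theta13OfThm1CCMW_cube_of_prop8TopStep_of_prop6Member_of_betaBoxW F hm hB₃ ha₀ h8 hB₁ hc₁ hP6 hB₉ ha₁' ha₁'le hγ₀ hγh hε hε' hb hbox hbox' hβ') lam8 lam12 lam13 Mstar ops ζ lamW w hC hγ hL hup h05 h06 h07 h08 h09 h09T h10 h11 h12 hUV hlo hhi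

end Summit.QuantumFields.YangMills.BalabanUVNodes.N24AtThm1CCMWDoorOfStepTokensB

end
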